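import Literature.Probability.LatticeModels.SquareTilingModulus
import Literature.Probability.LatticeModels.MeshDomainBulk
import Literature.Probability.Percolation.BoxCrossingProofs
import Literature.Probability.RandomPlanarGeometry.ExteriorULC
import Literature.Probability.LatticeModels.BoxDirichlet
import Literature.Probability.LatticeModels.LatticeLaplacianZd
import Literature.Probability.LatticeModels.LatticeHarmonicMeasure
import HarnessLib

/-!
# Square tilings of lattice domains: proofs towards [GP19] Corollary 4.15

Topic: Probability / LatticeModels. Companion of `SquareTilingModulus.lean`, which TYPES the
discretisation `Ω_n` of a Jordan domain used by A. Georgakopoulos and C. Panagiotis,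
*Convergence of square tilings to the Riemann map*, arXiv:1910.06886 (**[GP19]**), §3, and vendors
their Corollary 4.15 (the effective resistance between `T_n` and `B_n` converges to the extremal
length between `T` and `B`) as the named fact `GeorgakopoulosPanagiotis2019_cor415`.

This file starts the proof of that fact along the printed argument ([GP19], §4). It contains:

* §1 the elementary bookkeeping of the discretisation (`SquareTiling.innerGraph_adj_iff`,
  `domainGraph_adj_iff`, closure of `domain` under inner edges, finiteness of the vertex and edge
  sets for bounded `Ω`, the bounding-box count `ncard (domain Ω δ) ≤ (2⌈r/δ⌉+1)²`, and the
  disjointness of `T_n` and `B_n` under the standing separation assumption of [GP19], §3);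
* §2 **[GP19], Lemma 4.4** ("there is a constant `c = c(Ω) > 0` such that `I*_n ≤ c` for every
  `n`", `I*_n = 1 / R^eff_n`): the effective conductance between `T_n` and `B_n` is bounded,
  uniformly in the mesh, by `200 r² / ε²` where `Ω ⊆ B̄(0, r)` and `ε ≤ dist(T, B)`
  (`SquareTiling.effectiveConductance_arcVertices_le`), proved as printed: Duffin's discrete
  extremal length (`effectiveConductance_mul_edgeDist_sq_le` of `EffectiveResistance.lean`) with
  the constant edge length `W ≡ 1` — every lattice path from `T_n` to `B_n` has at least
  `(dist(T,B) - 2δ)/δ` edges, and `Ω_n` has at most `2 · (2⌈r/δ⌉+1)²` edges; and its dyadic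
  corollary `SquareTiling.eventually_effectiveConductance_le` for conformal rectangles;
* §3 the bulk of `Ω` lies in `Ω_n` for small meshes (`SquareTiling.exists_forall_mem_domain`),
  `T_n`, `B_n` are eventually nonempty (`SquareTiling.exists_forall_arcVertices_nonempty`) and
  `R^eff_n < ⊤` eventually;
* §4 **the potential `h_n`** ([GP19], §3.2): Dirichlet's principle has a harmonic minimiser
  (`SquareTiling.exists_harmonic_minimiser`, compactness + first variation), specialised to
  `Ω_n` in `SquareTiling.exists_potential`;
* §5 interior harmonicity of `h_n` on lattice boxes inside `Ω` and the interior gradient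
  estimate ([GP19], Thm 4.3, via the tree's `harmonic_box_gradient_le`):
  `SquareTiling.exists_forall_abs_sub_le`;
* §6 the compactness step of [GP19], Lemma 4.2 for the potentials: local equi-Lipschitz bounds
  (`SquareTiling.exists_forall_abs_sub_le_mul_dist`) and subsequential locally uniform limits of
  the piecewise-constant interpolants by a diagonal extraction on the rational points
  (`SquareTiling.exists_subseq_tendstoLocallyUniformly`);
* §7 boundary values ([GP19], Lemma 4.8, here WITHOUT Brownian motion): a closed lattice walk of
  inner edges has winding number `0` about any lattice face containing an exterior point
  (`SquareTiling.walkWinding_eq_zero_of_mem_exterior`: a fine-lattice path in the exterior,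
  bulk lemma of §3 applied to `(closure Ω)ᶜ`, shadowed by a coarse face walk,
  `SquareTiling.exists_faceWalk_of_fineWalk`), which feeds the weak discrete Beurling estimate
  of the tree (`le_add_rpow_of_noCircuit`, Smirnov 2010, Lemma B.2) applied to `1 - h_n` on the
  interior vertices of `Ω_n`: near an interior point of the arc where `h_n = 1`, `h_n ≥ 1 - ε`
  uniformly in the mesh (`SquareTiling.exists_forall_one_sub_le`).

Everything here is proved; no named fact is introduced. The proof continues in
`SquareTilingModulusLimsup.lean` (second differences, Fatou, the continuum step and the
upper half `lim sup_n R^eff_n ≤ d_Ω(T, B)` of Cor 4.15).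

## References

* [GeorgakopoulosPanagiotis2019] A. Georgakopoulos, C. Panagiotis, *Convergence of square tilings
  to the Riemann map*, arXiv:1910.06886 (2019), §3 (p. 7), §3.2, Thm 4.1, Lemma 4.2, Thm 4.3,
  Lemma 4.4 (p. 9), Thm 4.6, Lemma 4.8, Cor 4.15 (p. 16).
* [Ahlfors1973] L. V. Ahlfors, *Conformal Invariants*, McGraw-Hill 1973, Ch. 4 §4-1–4-2
  (extremal length, the tree's `ExtremalLength.lean`).
* [LawlerLimic2010] G. F. Lawler, V. Limic, *Random Walk: A Modern Introduction*, CUP 2010,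
  Thm 6.3.8 (difference estimates; the tree's `BoxDirichlet.lean`).
* [Smirnov2010] S. Smirnov, *Conformal invariance in random cluster models. I*, Ann. of Math. 172
  (2010), Appendix B, Lemma B.2 (weak Beurling; the tree's `WeakBeurlingEstimate.lean`).
* [LyonsPeres2016] R. Lyons, Y. Peres, *Probability on Trees and Networks*, CUP 2016,
  Exercise 2.78 (Duffin's discrete extremal length).
-/

noncomputable section

namespace Literature.Probability.LatticeModels

open _root_.Filter _root_.Set _root_.Metric
open scoped ENNReal NNReal _root_.Topology

namespace SquareTiling

/-! ### §1. Bookkeeping of the discretisation `Ω_n` -/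

section Basics

variable {Ω : Set ℂ} {δ : ℝ} {x y : Site 2}

/-- Adjacency in `innerGraph`, unfolded. [cite: GeorgakopoulosPanagiotis2019, §3] -/
theorem innerGraph_adj_iff :
    (innerGraph Ω δ).Adj x y ↔
      (zdGraph 2).Adj x y ∧ segment ℝ (meshPoint δ x) (meshPoint δ y) ⊆ Ω := by
  simp only [innerGraph, SimpleGraph.fromRel_adj, ne_eq]
  constructor
  · rintro ⟨-, h | h⟩
    · exact h
    · exact ⟨h.1.symm, segment_symm ℝ (meshPoint δ y) (meshPoint δ x) ▸ h.2⟩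
  · intro h
    exact ⟨h.1.ne, Or.inl h⟩

/-- `innerGraph` is a subgraph of `ℤ²`. [cite: GeorgakopoulosPanagiotis2019, §3] -/
theorem innerGraph_le_zdGraph (Ω : Set ℂ) (δ : ℝ) : innerGraph Ω δ ≤ zdGraph 2 :=
  fun _ _ h => (innerGraph_adj_iff.1 h).1

/-- Adjacency in `domainGraph`, unfolded. [cite: GeorgakopoulosPanagiotis2019, §3] -/
theorem domainGraph_adj_iff :
    (domainGraph Ω δ).Adj x y ↔ (innerGraph Ω δ).Adj x y ∧ x ∈ domain Ω δ ∧ y ∈ domain Ω δ := by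
  simp only [domainGraph, SimpleGraph.fromRel_adj, ne_eq]
  constructor
  · rintro ⟨-, h | h⟩
    · exact h
    · exact ⟨h.1.symm, h.2.2, h.2.1⟩
  · intro h
    exact ⟨h.1.ne, Or.inl h⟩

/-- `domainGraph` is a subgraph of `innerGraph`. [cite: GeorgakopoulosPanagiotis2019, §3] -/
theorem domainGraph_le_innerGraph (Ω : Set ℂ) (δ : ℝ) : domainGraph Ω δ ≤ innerGraph Ω δ :=
  fun _ _ h => (domainGraph_adj_iff.1 h).1

/-- `domainGraph` is a subgraph of `ℤ²`. [cite: GeorgakopoulosPanagiotis2019, §3] -/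
theorem domainGraph_le_zdGraph (Ω : Set ℂ) (δ : ℝ) : domainGraph Ω δ ≤ zdGraph 2 :=
  (domainGraph_le_innerGraph Ω δ).trans (innerGraph_le_zdGraph Ω δ)

/-- The component of the origin is closed under inner edges. [cite: GeorgakopoulosPanagiotis2019, §3] -/
theorem mem_domain_of_adj (hx : x ∈ domain Ω δ) (h : (innerGraph Ω δ).Adj x y) : y ∈ domain Ω δ :=
  SimpleGraph.Reachable.trans hx h.reachable

/-- Inside the component of the origin, `domainGraph` and `innerGraph` have the same edges.
[cite: GeorgakopoulosPanagiotis2019, §3] -/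
theorem domainGraph_adj_iff_of_mem (hx : x ∈ domain Ω δ) :
    (domainGraph Ω δ).Adj x y ↔ (innerGraph Ω δ).Adj x y :=
  ⟨fun h => (domainGraph_adj_iff.1 h).1, fun h => domainGraph_adj_iff.2 ⟨h, hx, mem_domain_of_adj hx h⟩⟩

/-- Reachability in `innerGraph` from the origin is reachability in `domainGraph`.
[cite: GeorgakopoulosPanagiotis2019, §3] -/
theorem domainGraph_reachable_of_mem (hx : x ∈ domain Ω δ) (hy : y ∈ domain Ω δ) :
    (domainGraph Ω δ).Reachable x y := by
  -- a walk from `0` to `x` and from `0` to `y` in `innerGraph` stays in `domain`, hence is a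
  -- walk of `domainGraph`
  suffices key : ∀ z, (innerGraph Ω δ).Reachable 0 z → (domainGraph Ω δ).Reachable 0 z from
    (key x hx).symm.trans (key y hy)
  intro z hz
  obtain ⟨p⟩ := hz
  -- induction along the walk, keeping the invariant that the current vertex is in `domain`
  suffices h : ∀ (a b : Site 2) (q : (innerGraph Ω δ).Walk a b), a ∈ domain Ω δ →
      (domainGraph Ω δ).Reachable a b from h 0 z p (zero_mem_domain Ω δ)
  intro a b q
  induction q with
  | nil => exact fun _ => SimpleGraph.Reachable.refl _
  | @cons a c b hac q ih =>
    intro ha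
    have hc : c ∈ domain Ω δ := mem_domain_of_adj ha hac
    exact (SimpleGraph.Adj.reachable ((domainGraph_adj_iff_of_mem ha).2 hac)).trans (ih hc)

/-- The mesh point of the right endpoint of an inner edge lies in `Ω`. [cite: GeorgakopoulosPanagiotis2019, §3] -/
theorem meshPoint_mem_of_adj (h : (innerGraph Ω δ).Adj x y) : meshPoint δ y ∈ Ω :=
  (innerGraph_adj_iff.1 h).2 (right_mem_segment ℝ _ _)

/-- The mesh point of the left endpoint of an inner edge lies in `Ω`. [cite: GeorgakopoulosPanagiotis2019, §3] -/
theorem meshPoint_mem_of_adj_left (h : (innerGraph Ω δ).Adj x y) : meshPoint δ x ∈ Ω :=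
  (innerGraph_adj_iff.1 h).2 (left_mem_segment ℝ _ _)

/-- A vertex of the component of the origin other than the origin is a mesh vertex of `Ω`
(its mesh point lies in `Ω`). [cite: GeorgakopoulosPanagiotis2019, §3] -/
theorem meshPoint_mem_of_mem_domain (hx : x ∈ domain Ω δ) (h0 : x ≠ 0) : meshPoint δ x ∈ Ω := by
  suffices key : ∀ (a b : Site 2), (innerGraph Ω δ).Walk a b → a ≠ b → meshPoint δ a ∈ Ω from
    key x 0 (Classical.choice (SimpleGraph.Reachable.symm hx)) h0
  intro a b p
  cases p with
  | nil => exact fun h => absurd rfl h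
  | cons h _ => exact fun _ => meshPoint_mem_of_adj_left h

/-- The mesh point of the lattice origin is the origin. [folklore] -/
@[simp] theorem meshPoint_zero (δ : ℝ) : meshPoint δ (0 : Site 2) = 0 := by
  apply Complex.ext <;> simp

/-- If the origin lies in `Ω`, every vertex of its component is a mesh vertex of `Ω`.
[cite: GeorgakopoulosPanagiotis2019, §3] -/
theorem domain_subset_meshVertices (h0 : (0 : ℂ) ∈ Ω) : domain Ω δ ⊆ meshVertices Ω δ := by
  intro x hx
  by_cases hx0 : x = 0
  · subst hx0
    rw [mem_meshVertices_iff, meshPoint_zero]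
    exact h0
  · exact meshPoint_mem_of_mem_domain hx hx0

/-- The component of the origin is contained in the mesh vertices of `Ω` together with the
origin. [cite: GeorgakopoulosPanagiotis2019, §3] -/
theorem domain_subset_insert : domain Ω δ ⊆ insert 0 (meshVertices Ω δ) := by
  intro x hx
  by_cases hx0 : x = 0
  · exact Or.inl hx0
  · exact Or.inr (meshPoint_mem_of_mem_domain hx hx0)

/-- For bounded `Ω` and `δ > 0` the component of the origin is finite.
[cite: GeorgakopoulosPanagiotis2019, §3] -/
theorem domain_finite (hΩ : Bornology.IsBounded Ω) (hδ : 0 < δ) : (domain Ω δ).Finite :=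
  ((meshVertices_finite hΩ hδ).insert 0).subset domain_subset_insert

/-- Every edge of `ℤ²` is `s(z, z + eᵢ)` for a vertex `z` of the edge and a coordinate `i`.
[folklore] -/
theorem exists_eq_mk_add_single (h : (zdGraph 2).Adj x y) :
    ∃ z i, (z = x ∨ z = y) ∧ s(x, y) = s(z, z + Pi.single i 1) := by
  obtain ⟨i, rfl | rfl⟩ := (zdGraph_adj_iff x y).1 h
  · exact ⟨x, i, Or.inl rfl, rfl⟩
  · exact ⟨y, i, Or.inr rfl, Sym2.eq_swap⟩

/-- The edges of `Ω_n` are among the `s(z, z + eᵢ)`, `z ∈ domain Ω δ`, `i : Fin 2`.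
[cite: GeorgakopoulosPanagiotis2019, §3] -/
theorem edgeSet_domainGraph_subset_image :
    (domainGraph Ω δ).edgeSet ⊆
      (fun p : Site 2 × Fin 2 => s(p.1, p.1 + Pi.single p.2 1)) '' (domain Ω δ ×ˢ univ) := by
  refine Sym2.ind (fun x y hxy => ?_)
  rw [SimpleGraph.mem_edgeSet] at hxy
  obtain ⟨hin, hx, hy⟩ := domainGraph_adj_iff.1 hxy
  obtain ⟨z, i, hz, he⟩ := exists_eq_mk_add_single (innerGraph_le_zdGraph Ω δ hin)
  refine ⟨(z, i), ⟨?_, mem_univ _⟩, he.symm⟩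
  rcases hz with rfl | rfl
  · exact hx
  · exact hy

/-- For bounded `Ω` and `δ > 0`, `Ω_n` has finitely many edges. [cite: GeorgakopoulosPanagiotis2019, §3] -/
theorem edgeSet_domainGraph_finite (hΩ : Bornology.IsBounded Ω) (hδ : 0 < δ) :
    (domainGraph Ω δ).edgeSet.Finite :=
  (((domain_finite hΩ hδ).prod finite_univ).image _).subset edgeSet_domainGraph_subset_image

/-- `Ω_n` has at most twice as many edges as vertices. [cite: GeorgakopoulosPanagiotis2019, §3] -/
theorem ncard_edgeSet_domainGraph_le (hΩ : Bornology.IsBounded Ω) (hδ : 0 < δ) :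
    (domainGraph Ω δ).edgeSet.ncard ≤ 2 * (domain Ω δ).ncard := by
  have hfin : (domain Ω δ ×ˢ (univ : Set (Fin 2))).Finite := (domain_finite hΩ hδ).prod finite_univ
  calc (domainGraph Ω δ).edgeSet.ncard
      ≤ ((fun p : Site 2 × Fin 2 => s(p.1, p.1 + Pi.single p.2 1)) '' (domain Ω δ ×ˢ univ)).ncard :=
        ncard_le_ncard edgeSet_domainGraph_subset_image (hfin.image _)
    _ ≤ (domain Ω δ ×ˢ (univ : Set (Fin 2))).ncard := ncard_image_le hfin
    _ = 2 * (domain Ω δ).ncard := by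
        rw [ncard_prod, ncard_univ, Nat.card_eq_fintype_card, Fintype.card_fin, mul_comm]

/-- **Bounding-box count.** If `Ω ⊆ B̄(0, r)` and `δ > 0`, the component of the origin has at
most `(2⌈r/δ⌉₊ + 1)²` vertices. [folklore] -/
theorem ncard_domain_le {r : ℝ} (hr : 0 ≤ r) (hΩ : Ω ⊆ closedBall 0 r) (hδ : 0 < δ) :
    (domain Ω δ).ncard ≤ (2 * ⌈r / δ⌉₊ + 1) ^ 2 := by
  classical
  set m : ℕ := ⌈r / δ⌉₊ with hm
  set Box : Finset (Site 2) := Fintype.piFinset fun _ : Fin 2 => Finset.Icc (-(m : ℤ)) m with hBox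
  have hsub : domain Ω δ ⊆ (Box : Set (Site 2)) := by
    intro x hx
    have hnorm : ‖meshPoint δ x‖ ≤ r := by
      rcases domain_subset_insert hx with rfl | hx'
      · simp [hr]
      · simpa using hΩ hx'
    rw [Finset.mem_coe, hBox, Fintype.mem_piFinset]
    intro i
    rw [Finset.mem_Icc]
    have hcoord : |δ * (x i : ℝ)| ≤ r := by
      fin_cases i
      · exact le_trans (by simpa using Complex.abs_re_le_norm (meshPoint δ x)) hnorm
      · exact le_trans (by simpa using Complex.abs_im_le_norm (meshPoint δ x)) hnorm
    rw [abs_mul, abs_of_pos hδ] at hcoord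
    have h1 : |(x i : ℝ)| ≤ r / δ := by rwa [le_div_iff₀ hδ, mul_comm]
    have h2 : |(x i : ℝ)| ≤ (m : ℝ) := h1.trans (Nat.le_ceil _)
    rw [abs_le] at h2
    exact ⟨by exact_mod_cast h2.1, by exact_mod_cast h2.2⟩
  calc (domain Ω δ).ncard ≤ (Box : Set (Site 2)).ncard := ncard_le_ncard hsub (Finset.finite_toSet _)
    _ = Box.card := ncard_coe_finset _
    _ = (2 * m + 1) ^ 2 := by
        rw [hBox, Fintype.card_piFinset, Finset.prod_const, Finset.card_univ, Fintype.card_fin,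
          Int.card_Icc]
        congr 1
        omega

/-- Under the standing separation assumption of [GP19], §3 (`OppositeArcsSeparated`), no vertex
of `Ω_n` belongs to both `T_n` and `B_n` (two lattice edges at a common vertex meeting `T` and
`B` would be adjacent or equal edges meeting opposite arcs). [cite: GeorgakopoulosPanagiotis2019, §3] -/
theorem disjoint_arcVertices_of_oppositeArcsSeparated (R : RandomPlanarGeometry.ConformalRectangle)
    (h : OppositeArcsSeparated R δ) :
    Disjoint (arcVertices R.carrier δ (R.arc 0)) (arcVertices R.carrier δ (R.arc 2)) := by
  rw [Set.disjoint_left]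
  rintro x ⟨-, y, hxy, hT⟩ ⟨-, y', hxy', hB⟩
  exact (h x y x y' hxy hxy' ⟨meshPoint δ x, left_mem_segment ℝ _ _, left_mem_segment ℝ _ _⟩).1
    ⟨hT, hB⟩

/-- A vertex of `A_n` lies within `|δ|` of the arc `A`: it is an endpoint of a lattice edge (of
length `|δ|`) meeting `A`. [cite: GeorgakopoulosPanagiotis2019, §3] -/
theorem exists_dist_le_of_mem_arcVertices {A : Set ℂ} (hx : x ∈ arcVertices Ω δ A) :
    ∃ a ∈ A, dist (meshPoint δ x) a ≤ |δ| := by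
  obtain ⟨-, y, hxy, a, ha, haA⟩ := hx
  refine ⟨a, haA, ?_⟩
  have hsub : segment ℝ (meshPoint δ x) (meshPoint δ y) ⊆ closedBall (meshPoint δ x) |δ| :=
    (convex_closedBall _ _).segment_subset (mem_closedBall_self (abs_nonneg δ))
      (by rw [mem_closedBall, _root_.dist_comm, Percolation.dist_meshPoint_of_adj hxy])
  have := hsub ha
  rwa [mem_closedBall, _root_.dist_comm] at this

/-- Along a walk of `Ω_n` the mesh points move by at most `|δ|` per step. [folklore] -/
theorem dist_le_mul_length (p : (domainGraph Ω δ).Walk x y) :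
    dist (meshPoint δ x) (meshPoint δ y) ≤ |δ| * p.length := by
  induction p with
  | nil => simp
  | @cons a b c hab q ih =>
    have hab' : (zdGraph 2).Adj a b := domainGraph_le_zdGraph Ω δ hab
    calc dist (meshPoint δ a) (meshPoint δ c)
        ≤ dist (meshPoint δ a) (meshPoint δ b) + dist (meshPoint δ b) (meshPoint δ c) := dist_triangle _ _ _
      _ ≤ |δ| + |δ| * q.length := by rw [Percolation.dist_meshPoint_of_adj hab']; gcongr
      _ = |δ| * (SimpleGraph.Walk.cons hab q).length := by
          rw [SimpleGraph.Walk.length_cons]; push_cast; ring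

end Basics

/-! ### §2. [GP19], Lemma 4.4: the effective conductance between `T_n` and `B_n` is bounded -/

section Lemma44

variable {Ω : Set ℂ} {δ : ℝ}

/-- With unit edge lengths, the `W`-length of a walk is its number of edges. [folklore] -/
theorem walkLength_one {V : Type*} {G : SimpleGraph V} {x y : V} (p : G.Walk x y) :
    walkLength (fun _ => (1 : ℝ≥0)) p = p.length := by
  simp [walkLength, SimpleGraph.Walk.length_edges]

/-- With unit edge lengths and unit conductances, the network area is the number of edges
(for a graph with finitely many edges). [folklore] -/
theorem networkArea_one_one {V : Type*} (G : SimpleGraph V) (hG : G.edgeSet.Finite) :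
    networkArea G 1 (fun _ => (1 : ℝ≥0)) = G.edgeSet.ncard := by
  classical
  have h0 : ∀ e ∉ hG.toFinset,
      G.edgeSet.indicator (fun e ↦ ((1 : Sym2 V → ℝ≥0) e : ℝ≥0∞) * ((1 : ℝ≥0) : ℝ≥0∞) ^ 2) e = 0 :=
    fun e he ↦ indicator_of_notMem (fun h => he (hG.mem_toFinset.2 h)) _
  rw [networkArea, tsum_eq_sum h0, Finset.sum_congr rfl fun e he =>
    indicator_of_mem (hG.mem_toFinset.1 he) _]
  simp [ncard_eq_toFinset_card G.edgeSet hG]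

/-- **Paths from `T_n` to `B_n` are long.** If every point of `T` is at distance `≥ ε` from
every point of `B`, every walk of `Ω_n` from `T_n` to `B_n` has at least `(ε - 2δ)/δ` edges:
its endpoints are within `δ` of `T` and `B` and each edge has length `δ` ([GP19], proof of
Lemma 4.4: "this sum is bounded from below by the distance between `T_n` and `B_n`").
[cite: GeorgakopoulosPanagiotis2019, Lemma 4.4] -/
theorem sub_le_mul_length {T B : Set ℂ} {ε : ℝ} (hε : ∀ a ∈ T, ∀ b ∈ B, ε ≤ dist a b)
    (hδ : 0 < δ) {x y : Site 2} (hx : x ∈ arcVertices Ω δ T) (hy : y ∈ arcVertices Ω δ B)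
    (p : (domainGraph Ω δ).Walk x y) : ε - 2 * δ ≤ δ * p.length := by
  obtain ⟨a, haT, ha⟩ := exists_dist_le_of_mem_arcVertices hx
  obtain ⟨b, hbB, hb⟩ := exists_dist_le_of_mem_arcVertices hy
  rw [abs_of_pos hδ] at ha hb
  have hp := dist_le_mul_length p
  rw [abs_of_pos hδ] at hp
  have := hε a haT b hbB
  have htri : dist a b ≤ dist a (meshPoint δ x) + dist (meshPoint δ x) (meshPoint δ y) +
      dist (meshPoint δ y) b := dist_triangle4 _ _ _ _
  rw [_root_.dist_comm] at ha
  linarith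

/-- The unit-length distance from `T_n` to `B_n` in `Ω_n` is at least `(ε - 2δ)/δ`.
[cite: GeorgakopoulosPanagiotis2019, Lemma 4.4] -/
theorem le_edgeDist_one {T B : Set ℂ} {ε : ℝ} (hε : ∀ a ∈ T, ∀ b ∈ B, ε ≤ dist a b) (hδ : 0 < δ) :
    ENNReal.ofReal ((ε - 2 * δ) / δ) ≤
      edgeDist (domainGraph Ω δ) (fun _ => (1 : ℝ≥0)) (arcVertices Ω δ T) (arcVertices Ω δ B) := by
  refine le_edgeDist fun x hx y hy p => ?_
  rw [walkLength_one, ENNReal.coe_natCast]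
  have h := sub_le_mul_length hε hδ hx hy p
  have h' : (ε - 2 * δ) / δ ≤ p.length := by rw [div_le_iff₀ hδ]; linarith
  calc ENNReal.ofReal ((ε - 2 * δ) / δ) ≤ ENNReal.ofReal (p.length : ℝ) := ENNReal.ofReal_le_ofReal h'
    _ = (p.length : ℝ≥0∞) := by rw [ENNReal.ofReal_natCast]

/-- **[GP19], Lemma 4.4** (uniform bound on the effective conductance, i.e. on the intensity
`I*_n = 1/R^eff_n`), quantitative form for a general bounded open set: if `Ω ⊆ B̄(0, r)`, every
point of `T` is at distance `≥ ε` from every point of `B`, `0 < δ ≤ r` and `4δ ≤ ε`, then the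
unit-conductance effective conductance of `Ω_n` between `T_n` and `B_n` is at most
`200 r² / ε²`. Proof as printed: by Duffin's discrete extremal length
(`effectiveConductance_mul_edgeDist_sq_le`) with constant edge lengths, using
`le_edgeDist_one` (paths are long) and the edge count `≤ 2 (2⌈r/δ⌉+1)² ≤ 50 r²/δ²`
(squares attached to distinct parallel edges are disjoint, in the paper's wording).
[cite: GeorgakopoulosPanagiotis2019, Lemma 4.4] -/
theorem effectiveConductance_arcVertices_le {r ε : ℝ} (hΩ : Ω ⊆ closedBall 0 r)
    (hΩb : Bornology.IsBounded Ω) {T B : Set ℂ} (hε : ∀ a ∈ T, ∀ b ∈ B, ε ≤ dist a b)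
    (hδ : 0 < δ) (hδr : δ ≤ r) (hδε : 4 * δ ≤ ε) :
    effectiveConductance (domainGraph Ω δ) 1 (arcVertices Ω δ T) (arcVertices Ω δ B) ≤
      ENNReal.ofReal (200 * r ^ 2 / ε ^ 2) := by
  have hr : 0 < r := hδ.trans_le hδr
  have hε0 : 0 < ε := by linarith
  set G := domainGraph Ω δ
  set W : Sym2 (Site 2) → ℝ≥0 := fun _ => 1 with hW
  -- Duffin: `𝒞 · dist_W² ≤ area_W`
  have hduff := effectiveConductance_mul_edgeDist_sq_le G 1 (arcVertices Ω δ T) (arcVertices Ω δ B) W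
  -- the distance is at least `ε / (2δ)`
  have hdist : ENNReal.ofReal (ε / (2 * δ)) ≤ edgeDist G W (arcVertices Ω δ T) (arcVertices Ω δ B) := by
    refine le_trans (ENNReal.ofReal_le_ofReal ?_) (le_edgeDist_one hε hδ)
    rw [div_le_div_iff₀ (by positivity) hδ]
    nlinarith
  -- the area is the number of edges, at most `50 r² / δ²`
  have hfin := edgeSet_domainGraph_finite hΩb hδ
  have harea : networkArea G 1 W ≤ ENNReal.ofReal (50 * r ^ 2 / δ ^ 2) := by
    rw [hW, networkArea_one_one G hfin]
    have h1 := ncard_edgeSet_domainGraph_le (Ω := Ω) hΩb hδ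
    have h2 := ncard_domain_le hr.le hΩ hδ
    have hceil : (⌈r / δ⌉₊ : ℝ) ≤ r / δ + 1 := (Nat.ceil_lt_add_one (by positivity)).le
    have hrd : 1 ≤ r / δ := by rwa [le_div_iff₀ hδ, one_mul]
    have hbound : ((2 * ⌈r / δ⌉₊ + 1) ^ 2 : ℕ) ≤ (25 * (r / δ) ^ 2 : ℝ) := by
      push_cast
      nlinarith
    have hE : (G.edgeSet.ncard : ℝ) ≤ 50 * r ^ 2 / δ ^ 2 := by
      calc (G.edgeSet.ncard : ℝ) ≤ 2 * ((domain Ω δ).ncard : ℝ) := by exact_mod_cast h1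
        _ ≤ 2 * ((2 * ⌈r / δ⌉₊ + 1) ^ 2 : ℕ) := by gcongr
        _ ≤ 2 * (25 * (r / δ) ^ 2) := by linarith
        _ = 50 * r ^ 2 / δ ^ 2 := by rw [div_pow]; ring
    calc (G.edgeSet.ncard : ℝ≥0∞) = ENNReal.ofReal (G.edgeSet.ncard : ℝ) := by rw [ENNReal.ofReal_natCast]
      _ ≤ ENNReal.ofReal (50 * r ^ 2 / δ ^ 2) := ENNReal.ofReal_le_ofReal hE
  -- combine
  have hd0 : ENNReal.ofReal (ε / (2 * δ)) ≠ 0 := by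
    rw [ne_eq, ENNReal.ofReal_eq_zero, not_le]; positivity
  have key : effectiveConductance G 1 (arcVertices Ω δ T) (arcVertices Ω δ B) *
      ENNReal.ofReal (ε / (2 * δ)) ^ 2 ≤ ENNReal.ofReal (50 * r ^ 2 / δ ^ 2) :=
    le_trans (by gcongr) (hduff.trans harea)
  rw [← ENNReal.le_div_iff_mul_le (Or.inl (pow_ne_zero 2 hd0)) (Or.inl (by simp))] at key
  refine key.trans (le_of_eq ?_)
  rw [← ENNReal.ofReal_pow (by positivity), ← ENNReal.ofReal_div_of_pos (by positivity)]
  congr 1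
  field_simp
  ring

/-- **[GP19], Lemma 4.4**, resistance form: under the same hypotheses,
`R^eff_n ≥ ε² / (200 r²) > 0`. [cite: GeorgakopoulosPanagiotis2019, Lemma 4.4] -/
theorem le_effectiveResistance_arcVertices {r ε : ℝ} (hΩ : Ω ⊆ closedBall 0 r)
    (hΩb : Bornology.IsBounded Ω) {T B : Set ℂ} (hε : ∀ a ∈ T, ∀ b ∈ B, ε ≤ dist a b)
    (hδ : 0 < δ) (hδr : δ ≤ r) (hδε : 4 * δ ≤ ε) :
    (ENNReal.ofReal (200 * r ^ 2 / ε ^ 2))⁻¹ ≤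
      effectiveResistance (domainGraph Ω δ) 1 (arcVertices Ω δ T) (arcVertices Ω δ B) :=
  ENNReal.inv_le_inv.2 (effectiveConductance_arcVertices_le hΩ hΩb hε hδ hδr hδε)

/-- **[GP19], Lemma 4.4** for a conformal rectangle along the dyadic meshes `δ = 2⁻ⁿ`: the
effective conductances `𝒞(T_n ↔ B_n)` of `Ω_n` are eventually bounded by a finite constant
(equivalently, "`R^eff_n` is bounded from below by a strictly positive real number").
[cite: GeorgakopoulosPanagiotis2019, Lemma 4.4] -/
theorem eventually_effectiveConductance_le (R : RandomPlanarGeometry.ConformalRectangle) :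
    ∃ K : ℝ≥0, ∀ᶠ n : ℕ in atTop,
      effectiveConductance (domainGraph R.carrier ((2 : ℝ)⁻¹ ^ n)) 1
          (arcVertices R.carrier ((2 : ℝ)⁻¹ ^ n) (R.arc 0))
          (arcVertices R.carrier ((2 : ℝ)⁻¹ ^ n) (R.arc 2)) ≤ K := by
  obtain ⟨ε, hε, hεd⟩ := R.exists_pos_forall_lt_dist_arc
  obtain ⟨r₀, hr₀⟩ := (isBounded_iff_subset_closedBall (0 : ℂ)).1 R.isBounded
  set r := max r₀ 1 with hr
  have hΩ : R.carrier ⊆ closedBall 0 r := hr₀.trans (closedBall_subset_closedBall (le_max_left _ _))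
  have hr1 : 1 ≤ r := le_max_right _ _
  have hK0 : (0 : ℝ) ≤ 200 * r ^ 2 / ε ^ 2 := by positivity
  refine ⟨⟨200 * r ^ 2 / ε ^ 2, hK0⟩, ?_⟩
  -- `2⁻ⁿ → 0`, so eventually `2⁻ⁿ ≤ min r (ε/4)`
  have htend : Tendsto (fun n : ℕ => ((2 : ℝ)⁻¹) ^ n) atTop (𝓝 0) :=
    tendsto_pow_atTop_nhds_zero_of_lt_one (by norm_num) (by norm_num)
  have hpos : 0 < min r (ε / 4) := lt_min (by linarith) (by linarith)
  filter_upwards [(tendsto_order.1 htend).2 _ hpos] with n hn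
  have hδ : (0 : ℝ) < (2 : ℝ)⁻¹ ^ n := by positivity
  refine (effectiveConductance_arcVertices_le hΩ R.isBounded (fun a ha b hb => (hεd a ha b hb).le)
    hδ (hn.le.trans (min_le_left _ _)) ?_).trans (le_of_eq ?_)
  · linarith [hn.le.trans (min_le_right r (ε / 4))]
  · exact ENNReal.ofReal_eq_coe_nnreal hK0

end Lemma44

/-! ### §3. The bulk of `Ω` lies in `Ω_n`; `T_n`, `B_n` are eventually nonempty and joined -/

section Bulk

variable {Ω : Set ℂ} {δ : ℝ}

/-- **Staircase lemma with a failure exit.** Walk from `a ∈ domain Ω δ` towards `b` along a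
monotone lattice staircase inside the rectangle spanned by the two mesh points: either `b` is
reached inside `domain Ω δ`, or some step is a lattice edge at a vertex of `domain Ω δ` that is
not an inner edge of `Ω` (its closed segment leaves `Ω`). Stated for `b ∉ domain Ω δ`.
[folklore] -/
theorem exists_not_adj_of_not_mem_domain (hδ : 0 < δ) :
    ∀ (n : ℕ) (a b : Site 2), (b 0 - a 0).natAbs + (b 1 - a 1).natAbs = n →
      a ∈ domain Ω δ → b ∉ domain Ω δ →
      ∃ u v : Site 2, u ∈ domain Ω δ ∧ (zdGraph 2).Adj u v ∧ ¬ (innerGraph Ω δ).Adj u v ∧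
        meshPoint δ u ∈ Complex.Rectangle (meshPoint δ a) (meshPoint δ b) ∧
        meshPoint δ v ∈ Complex.Rectangle (meshPoint δ a) (meshPoint δ b) := by
  intro n
  induction n with
  | zero =>
    intro a b hn ha hb
    have hab : a = b := by
      ext j; fin_cases j <;> simp <;> omega
    subst hab
    exact absurd ha hb
  | succ n ih =>
    intro a b hn ha hb
    obtain ⟨i, hi⟩ : ∃ i : Fin 2, a i ≠ b i := by
      by_contra! h
      have h0 := h 0; have h1 := h 1
      omega
    set s : ℤ := if a i < b i then 1 else -1 with hs_def
    have hs : s = 1 ∨ s = -1 := by rw [hs_def]; split_ifs <;> simp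
    set a' : Site 2 := a + Pi.single i s with ha'_def
    have ha'j : ∀ j, a' j = a j + if j = i then s else 0 := fun j => by
      rw [ha'_def, Pi.add_apply, Pi.single_apply]
    have hbetween : ∀ j, a' j ∈ uIcc (a j) (b j) := by
      intro j
      rw [ha'j j, mem_uIcc]
      by_cases hji : j = i
      · subst hji
        rw [if_pos rfl, hs_def]
        split_ifs with hlt
        · left; constructor <;> omega
        · right; constructor <;> omega
      · rw [if_neg hji, add_zero]
        rcases le_total (a j) (b j) with h | h
        · exact Or.inl ⟨le_rfl, h⟩
        · exact Or.inr ⟨h, le_rfl⟩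
    have hmemR : meshPoint δ a' ∈ Complex.Rectangle (meshPoint δ a) (meshPoint δ b) :=
      meshPoint_mem_rectangle hδ.le hbetween
    have hRsub : Complex.Rectangle (meshPoint δ a') (meshPoint δ b) ⊆ Complex.Rectangle (meshPoint δ a) (meshPoint δ b) :=
      rectangle_subset_of_mem hmemR
    have hsgn : (a i < b i ∧ s = 1) ∨ (b i < a i ∧ s = -1) := by
      rw [hs_def]
      split_ifs with h
      · exact Or.inl ⟨h, rfl⟩
      · exact Or.inr ⟨lt_of_le_of_ne (not_lt.1 h) (Ne.symm hi), rfl⟩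
    have hn' : (b 0 - a' 0).natAbs + (b 1 - a' 1).natAbs = n := by
      have h0 := ha'j 0
      have h1 := ha'j 1
      fin_cases i
      · simp only [Fin.zero_eta, Fin.isValue, ↓reduceIte, one_ne_zero] at h0 h1 hsgn
        rw [h0, h1]
        omega
      · simp only [Fin.mk_one, Fin.isValue, zero_ne_one, ↓reduceIte] at h0 h1 hsgn
        rw [h0, h1]
        omega
    have hadj : (zdGraph 2).Adj a a' := zdGraph_adj_add_single a i hs
    by_cases hin : (innerGraph Ω δ).Adj a a'
    · have ha' : a' ∈ domain Ω δ := mem_domain_of_adj ha hin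
      obtain ⟨u, v, hu, huv, hnot, huR, hvR⟩ := ih a' b hn' ha' hb
      exact ⟨u, v, hu, huv, hnot, hRsub huR, hRsub hvR⟩
    · exact ⟨a, a', ha, hadj, hin, left_mem_rectangle _ _, hmemR⟩

/-- **Staircase lemma** for the inner graph: if the closed rectangle spanned by the mesh points
of `a` and `b` lies in `Ω`, then `a` and `b` are joined in `innerGraph Ω δ` (monotone staircase;
each step is a closed segment inside the rectangle). [folklore] -/
theorem innerGraph_reachable_of_rectangle_subset (hδ : 0 < δ) :
    ∀ (n : ℕ) (a b : Site 2), (b 0 - a 0).natAbs + (b 1 - a 1).natAbs = n →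
      Complex.Rectangle (meshPoint δ a) (meshPoint δ b) ⊆ Ω → (innerGraph Ω δ).Reachable a b := by
  intro n
  induction n with
  | zero =>
    intro a b hn _
    have hab : a = b := by
      ext j; fin_cases j <;> simp <;> omega
    subst hab
    rfl
  | succ n ih =>
    intro a b hn hR
    obtain ⟨i, hi⟩ : ∃ i : Fin 2, a i ≠ b i := by
      by_contra! h
      have h0 := h 0; have h1 := h 1
      omega
    set s : ℤ := if a i < b i then 1 else -1 with hs_def
    have hs : s = 1 ∨ s = -1 := by rw [hs_def]; split_ifs <;> simp
    set a' : Site 2 := a + Pi.single i s with ha'_def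
    have ha'j : ∀ j, a' j = a j + if j = i then s else 0 := fun j => by
      rw [ha'_def, Pi.add_apply, Pi.single_apply]
    have hbetween : ∀ j, a' j ∈ uIcc (a j) (b j) := by
      intro j
      rw [ha'j j, mem_uIcc]
      by_cases hji : j = i
      · subst hji
        rw [if_pos rfl, hs_def]
        split_ifs with hlt
        · left; constructor <;> omega
        · right; constructor <;> omega
      · rw [if_neg hji, add_zero]
        rcases le_total (a j) (b j) with h | h
        · exact Or.inl ⟨le_rfl, h⟩
        · exact Or.inr ⟨h, le_rfl⟩
    have hmemR : meshPoint δ a' ∈ Complex.Rectangle (meshPoint δ a) (meshPoint δ b) :=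
      meshPoint_mem_rectangle hδ.le hbetween
    have hR' : Complex.Rectangle (meshPoint δ a') (meshPoint δ b) ⊆ Ω :=
      (rectangle_subset_of_mem hmemR).trans hR
    have hsgn : (a i < b i ∧ s = 1) ∨ (b i < a i ∧ s = -1) := by
      rw [hs_def]
      split_ifs with h
      · exact Or.inl ⟨h, rfl⟩
      · exact Or.inr ⟨lt_of_le_of_ne (not_lt.1 h) (Ne.symm hi), rfl⟩
    have hn' : (b 0 - a' 0).natAbs + (b 1 - a' 1).natAbs = n := by
      have h0 := ha'j 0
      have h1 := ha'j 1
      fin_cases i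
      · simp only [Fin.zero_eta, Fin.isValue, ↓reduceIte, one_ne_zero] at h0 h1 hsgn
        rw [h0, h1]
        omega
      · simp only [Fin.mk_one, Fin.isValue, zero_ne_one, ↓reduceIte] at h0 h1 hsgn
        rw [h0, h1]
        omega
    have hadj : (innerGraph Ω δ).Adj a a' := by
      refine innerGraph_adj_iff.2 ⟨zdGraph_adj_add_single a i hs, ?_⟩
      exact ((convex_rectangle _ _).segment_subset (left_mem_rectangle _ _) hmemR).trans hR
    exact hadj.reachable.trans (ih a' b hn' hR')

/-- **One component.** If `V` is preconnected and the ball of radius `ρ ≥ 3δ` about every point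
of `V` lies in `Ω`, then any two lattice points with mesh points in `V` are joined in
`innerGraph Ω δ` (the component of the lattice point nearest to `w` is a locally constant function
of `w ∈ V`, by the staircase lemma). [folklore] -/
theorem innerGraph_reachable_of_mem_bulk {V : Set ℂ} {ρ : ℝ} (hδ : 0 < δ) (hδρ : 3 * δ ≤ ρ)
    (hV : IsPreconnected V) (hVΩ : ∀ w ∈ V, ball w ρ ⊆ Ω) {x y : Site 2}
    (hx : meshPoint δ x ∈ V) (hy : meshPoint δ y ∈ V) : (innerGraph Ω δ).Reachable x y := by
  classical
  set G := innerGraph Ω δ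
  let f : ℂ → G.ConnectedComponent := fun w => G.connectedComponentMk (nearestSite δ w)
  letI : TopologicalSpace G.ConnectedComponent := ⊥
  haveI : DiscreteTopology G.ConnectedComponent := ⟨rfl⟩
  have key : ∀ z ∈ V, ∀ w, dist w z < δ / 4 → f w = f z := by
    intro z hz w hw
    have h1 : dist (meshPoint δ (nearestSite δ z)) z < 5 / 4 * δ :=
      (dist_meshPoint_nearestSite_le hδ z).trans_lt (by linarith)
    have h2 : dist (meshPoint δ (nearestSite δ w)) z < 5 / 4 * δ :=
      calc dist (meshPoint δ (nearestSite δ w)) z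
          ≤ dist (meshPoint δ (nearestSite δ w)) w + dist w z := dist_triangle _ _ _
        _ < δ + δ / 4 := add_lt_add_of_le_of_lt (dist_meshPoint_nearestSite_le hδ w) hw
        _ = 5 / 4 * δ := by ring
    have hR : Complex.Rectangle (meshPoint δ (nearestSite δ w)) (meshPoint δ (nearestSite δ z)) ⊆ Ω :=
      (rectangle_subset_ball h2 h1).trans ((ball_subset_ball (by linarith)).trans (hVΩ z hz))
    exact SimpleGraph.ConnectedComponent.sound
      (innerGraph_reachable_of_rectangle_subset hδ _ _ _ rfl hR)
  have hcont : ContinuousOn f V := by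
    intro z hz
    refine ContinuousAt.continuousWithinAt ((continuousAt_const (y := f z)).congr ?_)
    filter_upwards [ball_mem_nhds z (by positivity : (0 : ℝ) < δ / 4)] with w hw
    exact (key z hz w (mem_ball.1 hw)).symm
  have hfxy := hV.constant hcont hx hy
  have hfx : f (meshPoint δ x) = G.connectedComponentMk x := by
    show G.connectedComponentMk (nearestSite δ (meshPoint δ x)) = _
    rw [nearestSite_meshPoint hδ.ne']
  have hfy : f (meshPoint δ y) = G.connectedComponentMk y := by
    show G.connectedComponentMk (nearestSite δ (meshPoint δ y)) = _
    rw [nearestSite_meshPoint hδ.ne']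
  rw [hfx, hfy] at hfxy
  exact SimpleGraph.ConnectedComponent.exact hfxy

/-- **The bulk lies in `Ω_n`.** For a compact subset `K` of an open connected `Ω ∌ ∞`
containing the origin, for all small meshes every lattice point with mesh point in `K` lies in
the component of the origin `domain Ω δ` ([GP19], §4.1: "for every `n` large enough, `z` is
occupied by a vertex of `G_n`"). [cite: GeorgakopoulosPanagiotis2019, §4.1] -/
theorem exists_forall_mem_domain (hΩo : IsOpen Ω) (hΩc : IsConnected Ω) (hne : Ωᶜ.Nonempty)
    (h0 : (0 : ℂ) ∈ Ω) {K : Set ℂ} (hK : IsCompact K) (hKΩ : K ⊆ Ω) :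
    ∃ δ₀ > 0, ∀ δ, 0 < δ → δ < δ₀ → ∀ x : Site 2, meshPoint δ x ∈ K → x ∈ domain Ω δ := by
  obtain ⟨V, -, hVc, hKV, -, ρ, hρ, hρV⟩ :=
    exists_isOpen_isPreconnected_bulk hΩo hΩc hne (hK.insert 0) (insert_subset h0 hKΩ)
  have hVΩ : ∀ w ∈ V, ball w ρ ⊆ Ω := fun w hw =>
    ball_infDist_compl_subset.trans' (ball_subset_ball (hρV w hw).le)
  refine ⟨ρ / 3, by positivity, fun δ hδ hδρ x hx => ?_⟩
  have h0V : meshPoint δ (0 : Site 2) ∈ V := by rw [meshPoint_zero]; exact hKV (mem_insert _ _)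
  exact innerGraph_reachable_of_mem_bulk hδ (by linarith) hVc hVΩ h0V (hKV (mem_insert_of_mem _ hx))

/-- A lattice edge at a vertex of `Ω_n` (with `0 ∈ Ω`) that is not an inner edge meets `∂Ω`.
[cite: GeorgakopoulosPanagiotis2019, §3] -/
theorem exists_mem_frontier_of_not_adj (hΩo : IsOpen Ω) (h0 : (0 : ℂ) ∈ Ω) {u v : Site 2}
    (hu : u ∈ domain Ω δ) (huv : (zdGraph 2).Adj u v) (hnot : ¬ (innerGraph Ω δ).Adj u v) :
    ∃ w ∈ segment ℝ (meshPoint δ u) (meshPoint δ v), w ∈ frontier Ω :=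
  Percolation.exists_mem_segment_frontier hΩo (domain_subset_meshVertices h0 hu)
    fun hseg => hnot (innerGraph_adj_iff.2 ⟨huv, hseg⟩)

/-- **`A_n` is eventually nonempty** for every boundary arc `A = R.arc i` of a conformal
rectangle whose domain contains the origin: for all small meshes some vertex of `Ω_n` is
incident to a lattice edge meeting `∂Ω` inside `A` (walk from a lattice point of the bulk near an
interior point `q` of the arc towards a nearby exterior point; the first failing edge meets `∂Ω`
within the neighbourhood of `q` that sees only the arc `A`). [cite: GeorgakopoulosPanagiotis2019, §3] -/
theorem exists_forall_arcVertices_nonempty (R : RandomPlanarGeometry.ConformalRectangle)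
    (h0 : (0 : ℂ) ∈ R.carrier) (i : Fin 4) :
    ∃ δ₀ > 0, ∀ δ, 0 < δ → δ < δ₀ → (arcVertices R.carrier δ (R.arc i)).Nonempty := by
  set Ω := R.carrier
  -- an interior point `q` of the arc and a radius `r` seeing only the arc `i`
  set t : ℝ := (R.mark i + R.nextMark i) / 2 with ht
  have htI := R.midpoint_mem_Ioo i
  set q : ℂ := R.boundary t with hq
  have hqA : q ∈ R.arc i := mem_image_of_mem _ (Ioo_subset_Icc_self htI)
  obtain ⟨r, hr, hrA, -⟩ := R.exists_pos_forall_mem_arc_of_dist_lt i htI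
  have hqf : q ∈ frontier Ω := R.arc_subset_frontier i hqA
  -- an exterior point `e` near `q`, with a small ball outside `Ω̄`
  obtain ⟨e, he, hed⟩ := Metric.mem_closure_iff.1 (R.frontier_subset_closure_exterior' hqf) (r / 8)
    (by positivity)
  obtain ⟨s, hs, hse⟩ := Metric.isOpen_iff.1 (isClosed_closure (s := Ω)).isOpen_compl e he
  -- a point `z ∈ Ω` near `q`, with a small closed ball inside `Ω`
  obtain ⟨z, hz, hzd⟩ := R.exists_mem_carrier_dist_lt i hqA (ε := r / 8) (by positivity)
  obtain ⟨s', hs', hs'z⟩ := Metric.isOpen_iff.1 R.isOpen z hz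
  have hKΩ : closedBall z (s' / 2) ⊆ Ω := (closedBall_subset_ball (by linarith)).trans hs'z
  have hne : Ωᶜ.Nonempty := ⟨q, fun h => (R.disjoint_carrier_frontier.ne_of_mem h hqf) rfl⟩
  obtain ⟨δ₁, hδ₁, hdom⟩ := exists_forall_mem_domain R.isOpen R.isConnected hne h0
    (isCompact_closedBall z (s' / 2)) hKΩ
  refine ⟨min (min δ₁ s) (min (s' / 2) (r / 8)), by positivity, fun δ hδ hδlt => ?_⟩
  have hδ₁' : δ < δ₁ := hδlt.trans_le ((min_le_left _ _).trans (min_le_left _ _))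
  have hδs : δ < s := hδlt.trans_le ((min_le_left _ _).trans (min_le_right _ _))
  have hδs' : δ < s' / 2 := hδlt.trans_le ((min_le_right _ _).trans (min_le_left _ _))
  have hδr : δ < r / 8 := hδlt.trans_le ((min_le_right _ _).trans (min_le_right _ _))
  -- the starting point `x₀` (in the bulk) and the target `x₁` (outside `Ω̄`)
  set x₀ := nearestSite δ z with hx₀
  set x₁ := nearestSite δ e with hx₁
  have hx₀K : meshPoint δ x₀ ∈ closedBall z (s' / 2) :=
    mem_closedBall.2 ((dist_meshPoint_nearestSite_le hδ z).trans hδs'.le)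
  have hx₀D : x₀ ∈ domain Ω δ := hdom δ hδ hδ₁' x₀ hx₀K
  have hx₁e : meshPoint δ x₁ ∈ (closure Ω)ᶜ :=
    hse (mem_ball.2 ((dist_meshPoint_nearestSite_le hδ e).trans_lt hδs))
  have hx₁D : x₁ ∉ domain Ω δ := fun h =>
    hx₁e (subset_closure (domain_subset_meshVertices h0 h))
  -- the first failing edge of the staircase from `x₀` to `x₁`
  obtain ⟨u, v, hu, huv, hnot, huR, hvR⟩ :=
    exists_not_adj_of_not_mem_domain hδ _ x₀ x₁ rfl hx₀D hx₁D
  obtain ⟨w, hw, hwf⟩ := exists_mem_frontier_of_not_adj R.isOpen h0 hu huv hnot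
  -- it meets `∂Ω` within distance `r` of `q`, hence inside the arc `i`
  have hRect : Complex.Rectangle (meshPoint δ x₀) (meshPoint δ x₁) ⊆ ball q r := by
    have h2 : (2 : ℝ) * (r / 2) = r := by ring
    rw [← h2]
    refine rectangle_subset_ball ?_ ?_
    · -- `ball z s' ⊆ Ω` misses `q ∉ Ω`, so `s' ≤ dist q z < r / 8`
      have hqz : s' ≤ dist z q := by
        by_contra hlt
        rw [not_le, dist_comm] at hlt
        exact (R.disjoint_carrier_frontier.ne_of_mem (hs'z (mem_ball.2 hlt)) hqf) rfl
      calc dist (meshPoint δ x₀) q ≤ dist (meshPoint δ x₀) z + dist z q := dist_triangle _ _ _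
        _ ≤ s' / 2 + dist z q := by gcongr; exact mem_closedBall.1 hx₀K
        _ < r / 2 := by linarith
    · -- `ball e s ⊆ (closure Ω)ᶜ` misses `q ∈ closure Ω`, so `s ≤ dist e q < r / 8`
      have hsq : s ≤ dist q e := by
        by_contra hlt
        rw [not_le] at hlt
        exact hse (mem_ball.2 hlt) (frontier_subset_closure hqf)
      have hed' : dist e q < r / 8 := by rwa [dist_comm] at hed
      calc dist (meshPoint δ x₁) q ≤ dist (meshPoint δ x₁) e + dist e q := dist_triangle _ _ _
        _ ≤ δ + dist e q := by gcongr; exact dist_meshPoint_nearestSite_le hδ e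
        _ < r / 2 := by rw [dist_comm] at hsq; linarith
  have hwq : dist w q < r :=
    mem_ball.1 (hRect ((convex_rectangle _ _).segment_subset huR hvR hw))
  have hwA : w ∈ R.arc i := hrA w hwf hwq
  exact ⟨u, ⟨⟨hu, v, huv, w, hw, hwf⟩, v, huv, w, hw, hwA⟩⟩

/-- `T_n` and `B_n` (indeed any two nonempty subsets of `Ω_n`) are joined in `Ω_n`, so the
effective resistance between them is finite. [cite: GeorgakopoulosPanagiotis2019, §3] -/
theorem effectiveResistance_arcVertices_lt_top {T B : Set ℂ} (hT : (arcVertices Ω δ T).Nonempty)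
    (hB : (arcVertices Ω δ B).Nonempty) :
    effectiveResistance (domainGraph Ω δ) 1 (arcVertices Ω δ T) (arcVertices Ω δ B) < ⊤ := by
  classical
  obtain ⟨x, hx⟩ := hT
  obtain ⟨y, hy⟩ := hB
  obtain ⟨p⟩ := domainGraph_reachable_of_mem (arcVertices_subset_domain Ω δ T hx)
    (arcVertices_subset_domain Ω δ B hy)
  set p' : (domainGraph Ω δ).Path x y := p.toPath
  refine (effectiveResistance_le_sum_inv hx hy p'.1 p'.2.isTrail.edges_nodup
    (fun e _ => by simp)).trans_lt ?_
  exact ENNReal.sum_lt_top.2 fun e _ => by simp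

/-- Along the dyadic meshes: eventually `T_n ≠ ∅`, `B_n ≠ ∅` and `R^eff_n < ⊤`.
[cite: GeorgakopoulosPanagiotis2019, §3] -/
theorem eventually_effectiveResistance_lt_top (R : RandomPlanarGeometry.ConformalRectangle)
    (h0 : (0 : ℂ) ∈ R.carrier) :
    ∀ᶠ n : ℕ in atTop,
      (arcVertices R.carrier ((2 : ℝ)⁻¹ ^ n) (R.arc 0)).Nonempty ∧
      (arcVertices R.carrier ((2 : ℝ)⁻¹ ^ n) (R.arc 2)).Nonempty ∧
      effectiveResistance (domainGraph R.carrier ((2 : ℝ)⁻¹ ^ n)) 1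
          (arcVertices R.carrier ((2 : ℝ)⁻¹ ^ n) (R.arc 0))
          (arcVertices R.carrier ((2 : ℝ)⁻¹ ^ n) (R.arc 2)) < ⊤ := by
  obtain ⟨δ₀, hδ₀, h₀⟩ := exists_forall_arcVertices_nonempty R h0 0
  obtain ⟨δ₂, hδ₂, h₂⟩ := exists_forall_arcVertices_nonempty R h0 2
  have htend : Tendsto (fun n : ℕ => ((2 : ℝ)⁻¹) ^ n) atTop (𝓝 0) :=
    tendsto_pow_atTop_nhds_zero_of_lt_one (by norm_num) (by norm_num)
  filter_upwards [(tendsto_order.1 htend).2 _ (lt_min hδ₀ hδ₂)] with n hn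
  have hδ : (0 : ℝ) < (2 : ℝ)⁻¹ ^ n := by positivity
  have hT := h₀ _ hδ (hn.trans_le (min_le_left _ _))
  have hB := h₂ _ hδ (hn.trans_le (min_le_right _ _))
  exact ⟨hT, hB, effectiveResistance_arcVertices_lt_top hT hB⟩

end Bulk

/-! ### §4. The discrete potential: Dirichlet's principle has a harmonic minimiser ([GP19], §3.2) -/

section Potential

variable {V : Type*} {G : SimpleGraph V} {A Z : Set V}

/-- With unit conductances and finitely many edges, the energy is the `ofReal` of the finite real
sum of squared increments. [folklore] -/
theorem networkEnergy_one_eq_ofReal_sum (G : SimpleGraph V) (hG : G.edgeSet.Finite) (v : V → ℝ) :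
    networkEnergy G 1 v = ENNReal.ofReal (∑ e ∈ hG.toFinset, sqIncr v e) := by
  classical
  have h0 : ∀ e ∉ hG.toFinset,
      G.edgeSet.indicator (fun e ↦ ((1 : Sym2 V → ℝ≥0) e : ℝ≥0∞) * ENNReal.ofReal (sqIncr v e)) e = 0 :=
    fun e he ↦ indicator_of_notMem (fun h => he (hG.mem_toFinset.2 h)) _
  rw [networkEnergy, tsum_eq_sum h0, ENNReal.ofReal_sum_of_nonneg fun e _ => sqIncr_nonneg v e]
  refine Finset.sum_congr rfl fun e he => ?_
  rw [indicator_of_mem (hG.mem_toFinset.1 he)]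
  simp

/-- The real energy `Σ_e dv(e)²` is a continuous function of the potential (product topology).
[folklore] -/
theorem continuous_sum_sqIncr (E : Finset (Sym2 V)) :
    Continuous fun v : V → ℝ => ∑ e ∈ E, sqIncr v e := by
  refine continuous_finsetSum E fun e _ => ?_
  induction e using Sym2.ind with
  | h a b =>
    simp only [sqIncr_mk]
    exact ((continuous_apply a).sub (continuous_apply b)).pow 2

/-- Clamping a potential to `[0, 1]` (`a ↦ max 0 (min 1 a)`, a contraction of `ℝ`) does not
increase its real energy. [folklore] -/
theorem sum_sqIncr_clamp01_le (E : Finset (Sym2 V)) (v : V → ℝ) :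
    ∑ e ∈ E, sqIncr (fun x => max 0 (min 1 (v x))) e ≤ ∑ e ∈ E, sqIncr v e := by
  have hlip : ∀ a b : ℝ, |max 0 (min 1 a) - max 0 (min 1 b)| ≤ |a - b| := fun a b => by
    have h1 : |min 1 a - min 1 b| ≤ |a - b| := abs_min_sub_min_le_max _ _ _ _ |>.trans (by simp)
    exact (abs_max_sub_max_le_max _ _ _ _).trans (by simpa using h1)
  refine Finset.sum_le_sum fun e _ => ?_
  induction e using Sym2.ind with
  | h a b =>
    simp only [sqIncr_mk]
    rw [← sq_abs (max 0 (min 1 (v a)) - _), ← sq_abs (v a - v b)]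
    exact pow_le_pow_left₀ (abs_nonneg _) (hlip _ _) 2

/-- **First variation of the energy at a vertex.** Changing the potential at a single vertex `x`
by `t` changes the real energy by `2t · Σ_{y ∼ x} (v x - v y) + t² · deg x` (finite edge set;
the neighbours of `x` listed by a finset `N`). [folklore] -/
theorem sum_sqIncr_update [DecidableEq V] (hG : G.edgeSet.Finite) (v : V → ℝ)
    (x : V) {N : Finset V} (hN : ∀ y, y ∈ N ↔ G.Adj x y) (t : ℝ) :
    ∑ e ∈ hG.toFinset, sqIncr (Function.update v x (v x + t)) e =
      ∑ e ∈ hG.toFinset, sqIncr v e +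
        (2 * t * ∑ y ∈ N, (v x - v y) + t ^ 2 * N.card) := by
  set v' := Function.update v x (v x + t) with hv'
  -- the difference is supported on the edges at `x`
  have hdiff : ∀ e ∈ hG.toFinset, sqIncr v' e - sqIncr v e =
      if x ∈ e then sqIncr v' e - sqIncr v e else 0 := by
    intro e _
    split_ifs with hx
    · rfl
    · induction e using Sym2.ind with
      | h a b =>
        have ha : a ≠ x := fun h => hx (h ▸ Sym2.mem_mk_left _ _)
        have hb : b ≠ x := fun h => hx (h ▸ Sym2.mem_mk_right _ _)
        simp [sqIncr_mk, hv', Function.update_of_ne ha, Function.update_of_ne hb]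
  have hsplit : ∑ e ∈ hG.toFinset, (sqIncr v' e - sqIncr v e) =
      ∑ e ∈ hG.toFinset.filter (x ∈ ·), (sqIncr v' e - sqIncr v e) := by
    rw [Finset.sum_filter]
    exact Finset.sum_congr rfl hdiff
  -- the edges at `x` are the `s(x, y)`, `y ∼ x`
  have himage : hG.toFinset.filter (x ∈ ·) = N.image fun y => s(x, y) := by
    ext e
    simp only [Finset.mem_filter, Set.Finite.mem_toFinset, Finset.mem_image, hN]
    constructor
    · rintro ⟨he, hxe⟩
      obtain ⟨y, rfl⟩ : ∃ y, e = s(x, y) := by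
        induction e using Sym2.ind with
        | h a b =>
          rcases Sym2.mem_iff.1 hxe with rfl | rfl
          · exact ⟨b, rfl⟩
          · exact ⟨a, Sym2.eq_swap⟩
      exact ⟨y, (SimpleGraph.mem_edgeSet G).1 he, rfl⟩
    · rintro ⟨y, hy, rfl⟩
      exact ⟨(SimpleGraph.mem_edgeSet G).2 hy, Sym2.mem_mk_left _ _⟩
  have hinj : Set.InjOn (fun y => s(x, y)) (N : Set V) := by
    intro y _ y' _ h
    rcases Sym2.eq_iff.1 h with ⟨_, h⟩ | ⟨h1, h2⟩
    · exact h
    · exact h2.trans h1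
  have hterm : ∀ y ∈ N,
      sqIncr v' s(x, y) - sqIncr v s(x, y) = 2 * t * (v x - v y) + t ^ 2 := by
    intro y hy
    have hyx : y ≠ x := (G.ne_of_adj ((hN y).1 hy)).symm
    simp only [sqIncr_mk, hv', Function.update_self, Function.update_of_ne hyx]
    ring
  have key : ∑ e ∈ hG.toFinset, (sqIncr v' e - sqIncr v e) =
      2 * t * ∑ y ∈ N, (v x - v y) + t ^ 2 * N.card := by
    rw [hsplit, himage, Finset.sum_image hinj, Finset.sum_congr rfl hterm, Finset.sum_add_distrib,
      Finset.mul_sum, Finset.sum_const, nsmul_eq_mul]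
    ring
  rw [← key, ← Finset.sum_add_distrib]
  exact Finset.sum_congr rfl fun e _ => by ring

/-- **Dirichlet's principle has a harmonic minimiser** (finite edge set, unit conductances,
disjoint boundary sets). There is a potential `h` with `h ≡ 1` on `A`, `h ≡ 0` on `Z`,
`0 ≤ h ≤ 1`, whose energy IS the effective conductance `𝒞(A ↔ Z)`, and which is harmonic —
`Σ_{y ∼ x} (h y - h x) = 0` — at every vertex outside `A ∪ Z` (Lyons–Peres 2016, Exercise 2.13;
[GP19], §3.2: "`h_n` is harmonic at every vertex in `V(G_n) ∖ {t_n, b_n}`", the voltage when a unit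
potential difference is imposed between `T_n` and `B_n`). Proof: the real energy is continuous on
the compact set of potentials with values in `[-1, 2]` and the given boundary values, so it has a
minimiser, which may be clamped to `[0, 1]` (clamping is a contraction); an interior minimiser has
vanishing first variation `2 Σ_{y ∼ x} (h x - h y)` at each free vertex; and every admissible
potential has energy at least that of its clamping, hence at least the minimum.
[cite: GeorgakopoulosPanagiotis2019, §3.2] -/
theorem exists_harmonic_minimiser [DecidableEq V] (hG : G.edgeSet.Finite)
    (hAZ : Disjoint A Z) (N : V → Finset V) (hN : ∀ x y, y ∈ N x ↔ G.Adj x y) :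
    ∃ h : V → ℝ, A.EqOn h 1 ∧ Z.EqOn h 0 ∧ (∀ x, h x ∈ Icc (0 : ℝ) 1) ∧
      networkEnergy G 1 h = effectiveConductance G 1 A Z ∧
      ∀ x, x ∉ A → x ∉ Z → ∑ y ∈ N x, (h y - h x) = 0 := by
  classical
  set E := hG.toFinset with hE
  set F : (V → ℝ) → ℝ := fun v => ∑ e ∈ E, sqIncr v e with hF
  set S : Set (V → ℝ) := {v | (∀ x, v x ∈ Icc (-1 : ℝ) 2) ∧ A.EqOn v 1 ∧ Z.EqOn v 0} with hS
  -- `S` is compact and nonempty, `F` is continuous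
  have hScpt : IsCompact S := by
    have h1 : IsCompact (Set.pi univ fun _ : V => Icc (-1 : ℝ) 2) :=
      isCompact_univ_pi fun _ => isCompact_Icc
    have hA : IsClosed {v : V → ℝ | A.EqOn v 1} := by
      have : {v : V → ℝ | A.EqOn v 1} = ⋂ a ∈ A, {v | v a = 1} := by
        ext v; simp [Set.EqOn]
      rw [this]
      exact isClosed_biInter fun a _ => isClosed_eq (continuous_apply a) continuous_const
    have hZ : IsClosed {v : V → ℝ | Z.EqOn v 0} := by
      have : {v : V → ℝ | Z.EqOn v 0} = ⋂ a ∈ Z, {v | v a = 0} := by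
        ext v; simp [Set.EqOn]
      rw [this]
      exact isClosed_biInter fun a _ => isClosed_eq (continuous_apply a) continuous_const
    have hSeq : S = (Set.pi univ fun _ : V => Icc (-1 : ℝ) 2) ∩ ({v | A.EqOn v 1} ∩ {v | Z.EqOn v 0}) := by
      ext v
      simp only [hS, mem_setOf_eq, mem_inter_iff, mem_univ_pi]
    rw [hSeq]
    exact h1.inter_right (hA.inter hZ)
  have h1S : ∀ v : V → ℝ, A.EqOn v 1 → Z.EqOn v 0 → (fun x => max 0 (min 1 (v x))) ∈ S := by
    intro v hvA hvZ
    refine ⟨fun x => ⟨by linarith [le_max_left 0 (min 1 (v x))],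
      by linarith [max_le zero_le_one (min_le_left 1 (v x))]⟩, fun a ha => ?_, fun a ha => ?_⟩
    · simp only [hvA ha, Pi.one_apply]; norm_num
    · simp only [hvZ ha, Pi.zero_apply]; norm_num
  have hSne : S.Nonempty := by
    refine ⟨_, h1S (A.indicator 1) (fun a ha => by simp [ha]) (fun a ha => ?_)⟩
    simp [Set.disjoint_right.1 hAZ ha]
  have hFc : Continuous F := continuous_sum_sqIncr E
  obtain ⟨h₀, hh₀S, hmin₀⟩ := hScpt.exists_isMinOn hSne hFc.continuousOn
  -- clamp the minimiser to `[0, 1]`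
  set h : V → ℝ := fun x => max 0 (min 1 (h₀ x)) with hh
  have hhS : h ∈ S := h1S h₀ hh₀S.2.1 hh₀S.2.2
  have hFh : F h ≤ F h₀ := sum_sqIncr_clamp01_le E h₀
  have hmin : ∀ v ∈ S, F h ≤ F v := fun v hv => hFh.trans (hmin₀ hv)
  have hhA : A.EqOn h 1 := hhS.2.1
  have hhZ : Z.EqOn h 0 := hhS.2.2
  have hh01 : ∀ x, h x ∈ Icc (0 : ℝ) 1 := fun x =>
    ⟨le_max_left _ _, max_le zero_le_one (min_le_left _ _)⟩
  refine ⟨h, hhA, hhZ, hh01, ?_, ?_⟩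
  · -- the energy of `h` is the effective conductance
    refine le_antisymm ?_ (effectiveConductance_le_networkEnergy hhA hhZ)
    refine le_effectiveConductance fun v hvA hvZ => ?_
    rw [networkEnergy_one_eq_ofReal_sum G hG, networkEnergy_one_eq_ofReal_sum G hG]
    exact ENNReal.ofReal_le_ofReal
      ((hmin _ (h1S v hvA hvZ)).trans (sum_sqIncr_clamp01_le E v))
  · -- harmonicity at the free vertices: vanishing first variation
    intro x hxA hxZ
    set a : ℝ := ∑ y ∈ N x, (h x - h y) with ha
    set d : ℝ := ((N x).card : ℝ) with hd
    have hvar : ∀ t : ℝ, |t| ≤ 1 → 0 ≤ 2 * t * a + t ^ 2 * d := by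
      intro t ht
      have hmem : Function.update h x (h x + t) ∈ S := by
        refine ⟨fun y => ?_, fun b hb => ?_, fun b hb => ?_⟩
        · by_cases hyx : y = x
          · subst hyx
            rw [Function.update_self]
            have := hh01 y
            constructor <;> linarith [this.1, this.2, (abs_le.1 ht).1, (abs_le.1 ht).2]
          · rw [Function.update_of_ne hyx]
            exact ⟨by linarith [(hh01 y).1], by linarith [(hh01 y).2]⟩
        · rw [Function.update_of_ne (show b ≠ x from fun hbx => hxA (hbx ▸ hb))]; exact hhA hb
        · rw [Function.update_of_ne (show b ≠ x from fun hbx => hxZ (hbx ▸ hb))]; exact hhZ hb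
      have := hmin _ hmem
      rw [hF] at this
      simp only at this
      rw [sum_sqIncr_update hG h x (hN x) t] at this
      linarith
    have hd0 : 0 ≤ d := by rw [hd]; positivity
    -- `|a| ≤ ε d / 2` for every `ε ∈ (0, 1]`, hence `a = 0`
    have habs : ∀ ε : ℝ, 0 < ε → ε ≤ 1 → |a| ≤ ε * d := by
      intro ε hε hε1
      have h1 := hvar ε (by rw [abs_of_pos hε]; exact hε1)
      have h2 := hvar (-ε) (by rw [abs_neg, abs_of_pos hε]; exact hε1)
      rw [abs_le]
      constructor <;> nlinarith
    have ha0 : a = 0 := by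
      by_contra hne
      have hpos : 0 < |a| := abs_pos.2 hne
      by_cases hd' : d = 0
      · have := habs 1 one_pos le_rfl
        rw [hd', mul_zero] at this
        linarith
      · have hdpos : 0 < d := lt_of_le_of_ne hd0 (Ne.symm hd')
        set ε := min 1 (|a| / (2 * d)) with hε
        have hε0 : 0 < ε := lt_min one_pos (by positivity)
        have h1 := habs ε hε0 (min_le_left _ _)
        have hle : ε * d ≤ |a| / (2 * d) * d := by gcongr; exact min_le_right _ _
        have h2 : |a| / (2 * d) * d = |a| / 2 := by field_simp
        rw [h2] at hle
        linarith
    have : ∑ y ∈ N x, (h y - h x) = -a := by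
      rw [ha, ← Finset.sum_neg_distrib]
      exact Finset.sum_congr rfl fun y _ => by ring
    rw [this, ha0, neg_zero]

end Potential

/-! ### §4b. The potential `h_n` of `Ω_n` -/

section DomainPotential

variable {Ω : Set ℂ} {δ : ℝ}

open Classical in
/-- The neighbours of `x` in `Ω_n`, as a finset: the lattice neighbours joined to `x` in
`domainGraph Ω δ`. [cite: GeorgakopoulosPanagiotis2019, §3] -/
theorem mem_filter_neighborFinset_iff (x y : Site 2) :
    y ∈ ((zdGraph 2).neighborFinset x).filter (fun y => (domainGraph Ω δ).Adj x y) ↔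
      (domainGraph Ω δ).Adj x y := by
  rw [Finset.mem_filter, SimpleGraph.mem_neighborFinset]
  exact ⟨fun h => h.2, fun h => ⟨domainGraph_le_zdGraph Ω δ h, h⟩⟩

open Classical in
/-- **The potential `h_n`** ([GP19], §3.2): for a conformal rectangle `R` (`Ω = R.carrier`
bounded) at a mesh `δ > 0` satisfying the separation assumption, there is `h : ℤ² → [0, 1]` with
`h ≡ 1` on `T_n`, `h ≡ 0` on `B_n`, harmonic for the graph `Ω_n` at every vertex outside
`T_n ∪ B_n`, whose energy is the effective conductance `𝒞(T_n ↔ B_n) = 1 / R^eff_n`.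
[cite: GeorgakopoulosPanagiotis2019, §3.2] -/
theorem exists_potential (R : RandomPlanarGeometry.ConformalRectangle) (hδ : 0 < δ)
    (hsep : OppositeArcsSeparated R δ) :
    ∃ h : Site 2 → ℝ,
      (arcVertices R.carrier δ (R.arc 0)).EqOn h 1 ∧ (arcVertices R.carrier δ (R.arc 2)).EqOn h 0 ∧
      (∀ x, h x ∈ Icc (0 : ℝ) 1) ∧
      networkEnergy (domainGraph R.carrier δ) 1 h =
        effectiveConductance (domainGraph R.carrier δ) 1 (arcVertices R.carrier δ (R.arc 0))
          (arcVertices R.carrier δ (R.arc 2)) ∧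
      ∀ x, x ∉ arcVertices R.carrier δ (R.arc 0) → x ∉ arcVertices R.carrier δ (R.arc 2) →
        ∑ y ∈ ((zdGraph 2).neighborFinset x).filter (fun y => (domainGraph R.carrier δ).Adj x y),
          (h y - h x) = 0 :=
  exists_harmonic_minimiser (edgeSet_domainGraph_finite R.isBounded hδ)
    (disjoint_arcVertices_of_oppositeArcsSeparated R hsep) _
    fun x y => mem_filter_neighborFinset_iff x y

end DomainPotential

/-! ### §5. Interior harmonicity of `h_n` and the interior gradient estimate ([GP19], §4.1, Thm 4.3) -/

section Interior

variable {Ω : Set ℂ} {δ : ℝ}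

/-- The neighbour sum of increments over the four lattice neighbours is the lattice Laplacian of
`LatticeLaplacian.lean`. [folklore] -/
theorem sum_neighborFinset_sub_eq_latticeLaplacian (h : Site 2 → ℝ) (x : Site 2) :
    ∑ y ∈ (zdGraph 2).neighborFinset x, (h y - h x) = latticeLaplacian h x := by
  rw [sum_neighborFinset_zdGraph, latticeLaplacian, Fin.sum_univ_four, Fin.sum_univ_two]
  simp only [cornerUnit, sub_eq_add_neg]
  ring

/-- The closed lattice square `[a₀, a₀ + N] × [a₁, a₁ + N]` at mesh `δ`, as a subset of `ℂ`: the
rectangle spanned by the mesh points of `a` and `a + (N, N)`. Lattice points with both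
coordinates in the integer ranges have mesh points in it. [folklore] -/
theorem meshPoint_mem_rectangle_of_mem_Icc (hδ : 0 ≤ δ) {a x : Site 2} {N : ℕ}
    (h0 : x 0 ∈ Icc (a 0) (a 0 + N)) (h1 : x 1 ∈ Icc (a 1) (a 1 + N)) :
    meshPoint δ x ∈ Complex.Rectangle (meshPoint δ a) (meshPoint δ (a + ![(N : ℤ), (N : ℤ)])) := by
  refine meshPoint_mem_rectangle hδ fun j => ?_
  fin_cases j
  · simpa [uIcc_of_le (show a 0 ≤ (a + ![(N : ℤ), (N : ℤ)]) 0 by simp)] using h0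
  · simpa [uIcc_of_le (show a 1 ≤ (a + ![(N : ℤ), (N : ℤ)]) 1 by simp)] using h1

/-- A rectangle with the second corner moved inside shrinks. [folklore] -/
theorem rectangle_subset_of_mem_right {z z' w : ℂ} (hz' : z' ∈ Complex.Rectangle z w) :
    Complex.Rectangle z z' ⊆ Complex.Rectangle z w := fun _ hp =>
  ⟨uIcc_subset_uIcc left_mem_uIcc hz'.1 hp.1, uIcc_subset_uIcc left_mem_uIcc hz'.2 hp.2⟩

open Classical in
/-- **Interior harmonicity of the potential.** Let `h` be harmonic for `Ω_n` off `T_n ∪ B_n`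
(the last clause of `exists_potential`). If the closed lattice square of side `N` with lower-left
corner `a ∈ domain Ω δ` lies (rescaled) inside `Ω`, then all its lattice points are vertices of
`Ω_n` joined by all the lattice edges of the square, none of its interior points lies in
`∂Ω_n ⊇ T_n ∪ B_n`, and `h` is lattice harmonic (four-neighbour Laplacian) on the open box
`boxInterior a N` ([GP19], §3.2 with §4.1: inside a closed disk `Δ ⊂ Ω`, for `n` large, the
vertices of `G_n` have degree `4` and `h_n` is harmonic there). [cite: GeorgakopoulosPanagiotis2019, §4.1] -/
theorem isLatticeHarmonicOn_boxInterior (hδ : 0 < δ) {T B : Set ℂ} (hΩo : IsOpen Ω)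
    {h : Site 2 → ℝ}
    (hharm : ∀ x, x ∉ arcVertices Ω δ T → x ∉ arcVertices Ω δ B →
      ∑ y ∈ ((zdGraph 2).neighborFinset x).filter (fun y => (domainGraph Ω δ).Adj x y),
        (h y - h x) = 0)
    {a : Site 2} {N : ℕ} (ha : a ∈ domain Ω δ)
    (hsq : Complex.Rectangle (meshPoint δ a) (meshPoint δ (a + ![(N : ℤ), (N : ℤ)])) ⊆ Ω) :
    IsLatticeHarmonicOn h (boxInterior a N) := by
  classical
  intro x hx
  obtain ⟨hx0, hx0', hx1, hx1'⟩ := hx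
  -- `x` and its four neighbours have mesh points in the square
  have hxI : x 0 ∈ Icc (a 0) (a 0 + N) ∧ x 1 ∈ Icc (a 1) (a 1 + N) := ⟨⟨by omega, by omega⟩, ⟨by omega, by omega⟩⟩
  have hnI : ∀ k : Fin 4, (x + cornerUnit k) 0 ∈ Icc (a 0) (a 0 + N) ∧
      (x + cornerUnit k) 1 ∈ Icc (a 1) (a 1 + N) := by
    intro k
    fin_cases k <;> simp [cornerUnit] <;> omega
  have hxR := meshPoint_mem_rectangle_of_mem_Icc hδ.le hxI.1 hxI.2
  -- `x ∈ domain` (staircase from `a` inside the square)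
  have hxD : x ∈ domain Ω δ := by
    refine SimpleGraph.Reachable.trans ha (innerGraph_reachable_of_rectangle_subset hδ _ a x rfl ?_)
    exact (rectangle_subset_of_mem_right hxR).trans hsq
  -- all four lattice edges at `x` are inner edges, hence edges of `Ω_n`
  have hadj : ∀ k : Fin 4, (domainGraph Ω δ).Adj x (x + cornerUnit k) := by
    intro k
    have hkR := meshPoint_mem_rectangle_of_mem_Icc hδ.le (hnI k).1 (hnI k).2
    refine (domainGraph_adj_iff_of_mem hxD).2 (innerGraph_adj_iff.2 ⟨cSrc_mem_edgeSet (x, k), ?_⟩)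
    exact ((convex_rectangle _ _).segment_subset hxR hkR).trans hsq
  -- no lattice edge at `x` meets `∂Ω`, so `x ∉ ∂Ω_n ⊇ T_n ∪ B_n`
  have hnotb : x ∉ boundary Ω δ := by
    rintro ⟨-, y, hxy, w, hw, hwf⟩
    obtain ⟨k, rfl⟩ : ∃ k : Fin 4, y = x + cornerUnit k := by
      obtain ⟨i, rfl | h⟩ := (zdGraph_adj_iff x y).1 hxy
      · fin_cases i
        · exact ⟨0, rfl⟩
        · exact ⟨1, rfl⟩
      · fin_cases i
        · exact ⟨2, by rw [h]; simp [cornerUnit]⟩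
        · exact ⟨3, by rw [h]; simp [cornerUnit]⟩
    have hkR := meshPoint_mem_rectangle_of_mem_Icc hδ.le (hnI k).1 (hnI k).2
    have hwΩ : w ∈ Ω := hsq ((convex_rectangle _ _).segment_subset hxR hkR hw)
    rw [hΩo.frontier_eq] at hwf
    exact hwf.2 hwΩ
  have hxT : x ∉ arcVertices Ω δ T := fun h => hnotb h.1
  have hxB : x ∉ arcVertices Ω δ B := fun h => hnotb h.1
  -- the filtered neighbour finset is the full one
  have hfilter : ((zdGraph 2).neighborFinset x).filter (fun y => (domainGraph Ω δ).Adj x y) =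
      (zdGraph 2).neighborFinset x := by
    refine Finset.filter_true_of_mem fun y hy => ?_
    rw [SimpleGraph.mem_neighborFinset] at hy
    obtain ⟨k, rfl⟩ : ∃ k : Fin 4, y = x + cornerUnit k := by
      obtain ⟨i, rfl | h⟩ := (zdGraph_adj_iff x y).1 hy
      · fin_cases i
        · exact ⟨0, rfl⟩
        · exact ⟨1, rfl⟩
      · fin_cases i
        · exact ⟨2, by rw [h]; simp [cornerUnit]⟩
        · exact ⟨3, by rw [h]; simp [cornerUnit]⟩
    exact hadj k
  have := hharm x hxT hxB
  rwa [hfilter, sum_neighborFinset_sub_eq_latticeLaplacian] at this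

/-- **Interior gradient estimate for the potential** ([GP19], Theorem 4.3, quoted from
Brandt 1966 / Lawler 1991; here from the tree's `harmonic_box_gradient_le`, Lawler–Limic
Thm 6.3.8): if `0 ≤ h ≤ 1` is lattice harmonic on the open box of side `N ≥ 16`, then its
increments on the middle region are at most `4 K / N`, `K = topGradConst`.
[cite: GeorgakopoulosPanagiotis2019, Theorem 4.3] -/
theorem abs_sub_le_of_mem_boxMiddle {h : Site 2 → ℝ} (h01 : ∀ x, h x ∈ Icc (0 : ℝ) 1) {a : Site 2}
    {N : ℕ} (hN : 16 ≤ N) (hharm : IsLatticeHarmonicOn h (boxInterior a N)) {x : Site 2}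
    (hx : x ∈ boxMiddle a N) (k : Fin 4) : |h (x + cornerUnit k) - h x| ≤ 4 * topGradConst / N := by
  have habs : ∀ y, |h y| ≤ 1 := fun y => by
    rw [abs_le]; exact ⟨by linarith [(h01 y).1], (h01 y).2⟩
  have := harmonic_box_gradient_le a N hN hharm zero_le_one
    (fun i _ _ => ⟨habs _, habs _, habs _, habs _⟩) hx k
  simpa using this

/-- Points of the closed lattice square of side `2M` centred at the lattice point `x` are within
`2 δ M` of the mesh point of `x` (`ℓ¹` bound). [folklore] -/
theorem dist_le_of_mem_square (hδ : 0 ≤ δ) {x : Site 2} {M : ℕ} {p : ℂ}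
    (hp : p ∈ Complex.Rectangle (meshPoint δ ![x 0 - M, x 1 - M])
      (meshPoint δ (![x 0 - M, x 1 - M] + ![((2 * M : ℕ) : ℤ), ((2 * M : ℕ) : ℤ)]))) :
    dist p (meshPoint δ x) ≤ 2 * δ * M := by
  obtain ⟨hre, him⟩ := hp
  simp only [meshPoint_re, meshPoint_im, Pi.add_apply, Matrix.cons_val_zero, Matrix.cons_val_one,
    Int.cast_sub, Int.cast_natCast, Int.cast_add, Int.cast_mul, Int.cast_ofNat, Nat.cast_mul,
    Nat.cast_ofNat] at hre him
  have hM : (0 : ℝ) ≤ δ * M := by positivity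
  rw [uIcc_of_le (by nlinarith)] at hre him
  rw [Complex.dist_eq]
  refine (Complex.norm_le_abs_re_add_abs_im _).trans ?_
  rw [Complex.sub_re, Complex.sub_im, meshPoint_re, meshPoint_im]
  have h1 : |p.re - δ * (x 0 : ℝ)| ≤ δ * M := by
    rw [abs_le]; constructor <;> nlinarith [hre.1, hre.2]
  have h2 : |p.im - δ * (x 1 : ℝ)| ≤ δ * M := by
    rw [abs_le]; constructor <;> nlinarith [him.1, him.2]
  linarith

open Classical in
/-- **Euclidean form of the interior gradient estimate.** If `B̄(z, r) ⊆ Ω` (`Ω` open connected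
with nonempty complement, `0 ∈ Ω`), then for all meshes `δ < δ₀` every potential `h`
of `Ω_n` (harmonic off `T_n ∪ B_n`, values in `[0,1]`) satisfies `|h(x + eₖ) - h(x)| ≤ 32 K δ / r`
(`K = topGradConst`, `eₖ` the four lattice directions) at every lattice point `x` whose mesh point
lies in `B(z, r/4)` ([GP19], §4.1: "for every closed disk `Δ ⊂ Ω`, the partial derivatives of
`h_n` on `Δ` are bounded" — the discrete partial derivative is `2ⁿ (h(x + eₖ) - h(x))`).
[cite: GeorgakopoulosPanagiotis2019, §4.1] -/
theorem exists_forall_abs_sub_le (hΩo : IsOpen Ω) (hΩc : IsConnected Ω) (hne : Ωᶜ.Nonempty)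
    (h0 : (0 : ℂ) ∈ Ω) {T B : Set ℂ} {z : ℂ} {r : ℝ} (hr : 0 < r) (hzr : closedBall z r ⊆ Ω) :
    ∃ δ₀ > 0, ∀ δ, 0 < δ → δ < δ₀ → ∀ h : Site 2 → ℝ, (∀ x, h x ∈ Icc (0 : ℝ) 1) →
      (∀ x, x ∉ arcVertices Ω δ T → x ∉ arcVertices Ω δ B →
        ∑ y ∈ ((zdGraph 2).neighborFinset x).filter (fun y => (domainGraph Ω δ).Adj x y),
          (h y - h x) = 0) →
      ∀ x : Site 2, meshPoint δ x ∈ ball z (r / 4) → ∀ k : Fin 4,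
        |h (x + cornerUnit k) - h x| ≤ 32 * topGradConst * δ / r := by
  classical
  obtain ⟨δ₀, hδ₀, hdom⟩ := exists_forall_mem_domain hΩo hΩc hne h0 (isCompact_closedBall z r) hzr
  refine ⟨min δ₀ (r / 72), by positivity, fun δ hδ hδlt h h01 hharm x hx k => ?_⟩
  have hδ₀' : δ < δ₀ := hδlt.trans_le (min_le_left _ _)
  have hδr : δ < r / 72 := hδlt.trans_le (min_le_right _ _)
  -- the box: side `N = 2M`, `M = ⌊r / (8δ)⌋ ≥ 8`, lower-left corner `a = x - (M, M)`
  set M : ℕ := ⌊r / (8 * δ)⌋₊ with hM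
  have hMle : (M : ℝ) ≤ r / (8 * δ) := Nat.floor_le (by positivity)
  have hMge : r / (8 * δ) - 1 ≤ M := (Nat.sub_one_lt_floor _).le
  have h9 : (9 : ℝ) ≤ r / (8 * δ) := by rw [le_div_iff₀ (by positivity)]; linarith
  have hM8 : 8 ≤ M := by
    have : (8 : ℝ) ≤ M := by linarith
    exact_mod_cast this
  set a : Site 2 := ![x 0 - M, x 1 - M] with ha
  have hxmid : x ∈ boxMiddle a (2 * M) := by
    refine ⟨?_, ?_, ?_, ?_⟩ <;> simp only [ha, Matrix.cons_val_zero, Matrix.cons_val_one] <;> push_cast <;> omega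
  -- the closed square lies in `B̄(z, r)`: its points are within `2δM ≤ r/4` of `δx ∈ B(z, r/4)`
  have hsqz : Complex.Rectangle (meshPoint δ a) (meshPoint δ (a + ![((2 * M : ℕ) : ℤ), ((2 * M : ℕ) : ℤ)]))
      ⊆ closedBall z r := by
    intro p hp
    have h1 := dist_le_of_mem_square hδ.le hp
    have h2 : 2 * δ * M ≤ r / 4 := by
      have := mul_le_mul_of_nonneg_left hMle (by positivity : (0 : ℝ) ≤ 2 * δ)
      rwa [show 2 * δ * (r / (8 * δ)) = r / 4 by field_simp; ring] at this
    rw [mem_closedBall]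
    calc dist p z ≤ dist p (meshPoint δ x) + dist (meshPoint δ x) z := dist_triangle _ _ _
      _ ≤ r / 4 + r / 4 := add_le_add (h1.trans h2) (mem_ball.1 hx).le
      _ ≤ r := by linarith
  have hsq := hsqz.trans hzr
  have haD : a ∈ domain Ω δ := hdom δ hδ hδ₀' a (hsqz (left_mem_rectangle _ _))
  have hharm' := isLatticeHarmonicOn_boxInterior hδ hΩo hharm haD hsq
  have hgrad := abs_sub_le_of_mem_boxMiddle h01 (by omega) hharm' hxmid k
  refine hgrad.trans ?_
  -- `4K/(2M) ≤ 32 K δ / r` since `2M ≥ r/(4δ) - 2 ≥ r/(8δ)`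
  have hK := topGradConst_pos
  have hN' : r / (8 * δ) ≤ ((2 * M : ℕ) : ℝ) := by push_cast; linarith
  have hNpos : (0 : ℝ) < ((2 * M : ℕ) : ℝ) := by positivity
  rw [div_le_div_iff₀ hNpos hr]
  calc 4 * topGradConst * r = 32 * topGradConst * δ * (r / (8 * δ)) := by field_simp; ring
    _ ≤ 32 * topGradConst * δ * ((2 * M : ℕ) : ℝ) := by gcongr

end Interior

/-! ### §6. Subsequential limits of the potentials ([GP19], Lemma 4.2, potential part) -/

section Limits

variable {Ω : Set ℂ} {δ : ℝ}

/-- A unit coordinate step `± eᵢ` is one of the four `cornerUnit`s. [folklore] -/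
theorem single_eq_cornerUnit (i : Fin 2) {s : ℤ} (hs : s = 1 ∨ s = -1) :
    ∃ k : Fin 4, (Pi.single i s : Site 2) = cornerUnit k := by
  have hneg : ∀ j : Fin 2, (Pi.single j (-1 : ℤ) : Site 2) = -Pi.single j 1 := fun j =>
    Pi.single_neg (f := fun _ : Fin 2 => ℤ) j (1 : ℤ)
  rcases hs with rfl | rfl
  · fin_cases i
    · exact ⟨0, rfl⟩
    · exact ⟨1, rfl⟩
  · refine ⟨if i = 0 then 2 else 3, ?_⟩
    rw [hneg]
    fin_cases i <;> rfl

/-- **Summing step bounds along a staircase.** If the increments of `h` across the four lattice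
directions are at most `Bd` at every lattice point with mesh point in `S`, then
`|h a - h b| ≤ Bd · ‖a - b‖₁` whenever the rectangle spanned by the two mesh points lies in `S`.
[folklore] -/
theorem abs_sub_le_mul_of_steps (hδ : 0 < δ) {S : Set ℂ} {h : Site 2 → ℝ} {Bd : ℝ}
    (hstep : ∀ x : Site 2, meshPoint δ x ∈ S → ∀ k : Fin 4, |h (x + cornerUnit k) - h x| ≤ Bd) :
    ∀ (n : ℕ) (a b : Site 2), (b 0 - a 0).natAbs + (b 1 - a 1).natAbs = n →
      Complex.Rectangle (meshPoint δ a) (meshPoint δ b) ⊆ S → |h a - h b| ≤ Bd * n := by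
  intro n
  induction n with
  | zero =>
    intro a b hn _
    have hab : a = b := by
      ext j; fin_cases j <;> simp <;> omega
    subst hab
    simp
  | succ n ih =>
    intro a b hn hR
    obtain ⟨i, hi⟩ : ∃ i : Fin 2, a i ≠ b i := by
      by_contra! h
      have h0 := h 0; have h1 := h 1
      omega
    set s : ℤ := if a i < b i then 1 else -1 with hs_def
    have hs : s = 1 ∨ s = -1 := by rw [hs_def]; split_ifs <;> simp
    set a' : Site 2 := a + Pi.single i s with ha'_def
    have ha'j : ∀ j, a' j = a j + if j = i then s else 0 := fun j => by
      rw [ha'_def, Pi.add_apply, Pi.single_apply]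
    have hbetween : ∀ j, a' j ∈ uIcc (a j) (b j) := by
      intro j
      rw [ha'j j, mem_uIcc]
      by_cases hji : j = i
      · subst hji
        rw [if_pos rfl, hs_def]
        split_ifs with hlt
        · left; constructor <;> omega
        · right; constructor <;> omega
      · rw [if_neg hji, add_zero]
        rcases le_total (a j) (b j) with h | h
        · exact Or.inl ⟨le_rfl, h⟩
        · exact Or.inr ⟨h, le_rfl⟩
    have hmemR : meshPoint δ a' ∈ Complex.Rectangle (meshPoint δ a) (meshPoint δ b) :=
      meshPoint_mem_rectangle hδ.le hbetween
    have hR' : Complex.Rectangle (meshPoint δ a') (meshPoint δ b) ⊆ S :=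
      (rectangle_subset_of_mem hmemR).trans hR
    have hsgn : (a i < b i ∧ s = 1) ∨ (b i < a i ∧ s = -1) := by
      rw [hs_def]
      split_ifs with h
      · exact Or.inl ⟨h, rfl⟩
      · exact Or.inr ⟨lt_of_le_of_ne (not_lt.1 h) (Ne.symm hi), rfl⟩
    have hn' : (b 0 - a' 0).natAbs + (b 1 - a' 1).natAbs = n := by
      have h0 := ha'j 0
      have h1 := ha'j 1
      fin_cases i
      · simp only [Fin.zero_eta, Fin.isValue, ↓reduceIte, one_ne_zero] at h0 h1 hsgn
        rw [h0, h1]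
        omega
      · simp only [Fin.mk_one, Fin.isValue, zero_ne_one, ↓reduceIte] at h0 h1 hsgn
        rw [h0, h1]
        omega
    -- the step `a → a'` is a step in one of the four lattice directions
    have hstep' : |h a' - h a| ≤ Bd := by
      obtain ⟨k, hk⟩ := single_eq_cornerUnit i hs
      rw [ha'_def, hk]
      exact hstep a (hR (left_mem_rectangle _ _)) k
    have := ih a' b hn' hR'
    calc |h a - h b| = |(h a - h a') + (h a' - h b)| := by ring_nf
      _ ≤ |h a - h a'| + |h a' - h b| := abs_add_le _ _
      _ ≤ Bd + Bd * n := add_le_add (by rw [abs_sub_comm]; exact hstep') this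
      _ = Bd * (n + 1 : ℕ) := by push_cast; ring

/-- The `ℓ¹` lattice distance is at most `2/δ` times the distance of the mesh points. [folklore] -/
theorem natAbs_add_natAbs_le (hδ : 0 < δ) (a b : Site 2) :
    (((b 0 - a 0).natAbs + (b 1 - a 1).natAbs : ℕ) : ℝ) * δ ≤
      2 * dist (meshPoint δ a) (meshPoint δ b) := by
  rw [Complex.dist_eq]
  have hre := Complex.abs_re_le_norm (meshPoint δ a - meshPoint δ b)
  have him := Complex.abs_im_le_norm (meshPoint δ a - meshPoint δ b)
  simp only [Complex.sub_re, Complex.sub_im, meshPoint_re, meshPoint_im, ← mul_sub, abs_mul,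
    abs_of_pos hδ] at hre him
  have h0 : (((b 0 - a 0).natAbs : ℕ) : ℝ) = |((a 0 : ℝ)) - (b 0 : ℝ)| := by
    rw [Nat.cast_natAbs, Int.cast_abs, abs_sub_comm]; push_cast; ring_nf
  have h1 : (((b 1 - a 1).natAbs : ℕ) : ℝ) = |((a 1 : ℝ)) - (b 1 : ℝ)| := by
    rw [Nat.cast_natAbs, Int.cast_abs, abs_sub_comm]; push_cast; ring_nf
  push_cast
  rw [h0, h1]
  nlinarith [abs_nonneg ((a 0 : ℝ) - b 0), abs_nonneg ((a 1 : ℝ) - b 1)]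

open Classical in
/-- **Local equi-Lipschitz bound for the potentials** ([GP19], §4.1: the interior gradient
estimate summed along lattice staircases). If `B̄(z, r) ⊆ Ω`, then for all meshes `δ < δ₀` every
potential of `Ω_n` satisfies `|h(x) - h(y)| ≤ (64 K / r) · |δx - δy|` for lattice points with mesh
points in `B(z, r/16)`. [cite: GeorgakopoulosPanagiotis2019, §4.1] -/
theorem exists_forall_abs_sub_le_mul_dist (hΩo : IsOpen Ω) (hΩc : IsConnected Ω) (hne : Ωᶜ.Nonempty)
    (h0 : (0 : ℂ) ∈ Ω) {T B : Set ℂ} {z : ℂ} {r : ℝ} (hr : 0 < r) (hzr : closedBall z r ⊆ Ω) :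
    ∃ δ₀ > 0, ∀ δ, 0 < δ → δ < δ₀ → ∀ h : Site 2 → ℝ, (∀ x, h x ∈ Icc (0 : ℝ) 1) →
      (∀ x, x ∉ arcVertices Ω δ T → x ∉ arcVertices Ω δ B →
        ∑ y ∈ ((zdGraph 2).neighborFinset x).filter (fun y => (domainGraph Ω δ).Adj x y),
          (h y - h x) = 0) →
      ∀ x y : Site 2, meshPoint δ x ∈ ball z (r / 16) → meshPoint δ y ∈ ball z (r / 16) →
        |h x - h y| ≤ 64 * topGradConst / r * dist (meshPoint δ x) (meshPoint δ y) := by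
  obtain ⟨δ₀, hδ₀, hstep⟩ := exists_forall_abs_sub_le hΩo hΩc hne h0 (T := T) (B := B) hr hzr
  refine ⟨δ₀, hδ₀, fun δ hδ hδlt h h01 hharm x y hx hy => ?_⟩
  have hK := topGradConst_pos
  have hRect : Complex.Rectangle (meshPoint δ x) (meshPoint δ y) ⊆ ball z (r / 4) := by
    have h2 : (2 : ℝ) * (r / 8) = r / 4 := by ring
    rw [← h2]
    exact rectangle_subset_ball ((mem_ball.1 hx).trans (by linarith)) ((mem_ball.1 hy).trans (by linarith))
  have key := abs_sub_le_mul_of_steps hδ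
    (fun x hx k => hstep δ hδ hδlt h h01 hharm x hx k) _ x y rfl hRect
  have hℓ := natAbs_add_natAbs_le hδ x y
  calc |h x - h y| ≤ 32 * topGradConst * δ / r * (((y 0 - x 0).natAbs + (y 1 - x 1).natAbs : ℕ) : ℝ) := key
    _ = 32 * topGradConst / r * ((((y 0 - x 0).natAbs + (y 1 - x 1).natAbs : ℕ) : ℝ) * δ) := by ring
    _ ≤ 32 * topGradConst / r * (2 * dist (meshPoint δ x) (meshPoint δ y)) := by gcongr
    _ = 64 * topGradConst / r * dist (meshPoint δ x) (meshPoint δ y) := by ring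

/-- Rational points are dense in `ℂ`: every point is within any `η > 0` of some `p + qi`,
`p q : ℚ`. [folklore] -/
theorem exists_rat_rat_dist_lt (w : ℂ) {η : ℝ} (hη : 0 < η) :
    ∃ q : ℚ × ℚ, dist (((q.1 : ℝ) : ℂ) + ((q.2 : ℝ) : ℂ) * Complex.I) w < η := by
  obtain ⟨p, hp1, hp2⟩ := exists_rat_btwn (show w.re - η / 2 < w.re + η / 2 by linarith)
  obtain ⟨q, hq1, hq2⟩ := exists_rat_btwn (show w.im - η / 2 < w.im + η / 2 by linarith)
  refine ⟨(p, q), ?_⟩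
  rw [Complex.dist_eq]
  refine (Complex.norm_le_abs_re_add_abs_im _).trans_lt ?_
  have hre : (((p : ℝ) : ℂ) + ((q : ℝ) : ℂ) * Complex.I - w).re = p - w.re := by simp
  have him : (((p : ℝ) : ℂ) + ((q : ℝ) : ℂ) * Complex.I - w).im = q - w.im := by simp
  rw [hre, him]
  have h1 : |(p : ℝ) - w.re| < η / 2 := by rw [abs_lt]; constructor <;> linarith
  have h2 : |(q : ℝ) - w.im| < η / 2 := by rw [abs_lt]; constructor <;> linarith
  linarith

/-- **Subsequential limits of equicontinuous lattice functions** ([GP19], Lemma 4.2 — the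
Arzelà–Ascoli step, here by a diagonal extraction on the rational points and the local
equi-Lipschitz bound instead of interpolation). Let `h n : ℤ² → [0, 1]` be functions read at the
meshes `δ n → 0`, locally uniformly equi-Lipschitz on the open set `Ω` in the sense of
`exists_forall_abs_sub_le_mul_dist`, and `c n` any sequence in `ℝ≥0∞`. Then along a
subsequence `φ`, `c (φ n)` converges and the piecewise-constant interpolants
`w ↦ h (φ n) ([w / δ])` converge locally uniformly on `Ω` to a locally Lipschitz function `v`
with values in `[0, 1]`. [cite: GeorgakopoulosPanagiotis2019, Lemma 4.2] -/
theorem exists_subseq_tendstoLocallyUniformly (hΩo : IsOpen Ω) {δs : ℕ → ℝ}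
    (hδ : ∀ n, 0 < δs n) (hδ0 : Tendsto δs atTop (𝓝 0)) {h : ℕ → Site 2 → ℝ}
    (h01 : ∀ n x, h n x ∈ Icc (0 : ℝ) 1)
    (hL : ∀ z ∈ Ω, ∃ r > 0, ∃ L ≥ (0 : ℝ), ∀ᶠ n in atTop, ∀ x y : Site 2,
      meshPoint (δs n) x ∈ ball z r → meshPoint (δs n) y ∈ ball z r →
        |h n x - h n y| ≤ L * dist (meshPoint (δs n) x) (meshPoint (δs n) y))
    (c : ℕ → ℝ≥0∞) :
    ∃ φ : ℕ → ℕ, StrictMono φ ∧ (∃ I : ℝ≥0∞, Tendsto (c ∘ φ) atTop (𝓝 I)) ∧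
      ∃ v : ℂ → ℝ, (∀ w, v w ∈ Icc (0 : ℝ) 1) ∧
        ∀ z ∈ Ω, ∃ r > 0, (∃ L ≥ (0 : ℝ), ∀ w ∈ ball z r, ∀ w' ∈ ball z r, |v w - v w'| ≤ L * dist w w') ∧
          TendstoUniformlyOn (fun n w => h (φ n) (nearestSite (δs (φ n)) w)) v atTop (ball z r) := by
  classical
  -- first extraction: the numbers `c n`
  obtain ⟨I, φ₁, hφ₁, hI⟩ := SeqCompactSpace.tendsto_subseq c
  -- second extraction: values at the rational points
  set ev : ℚ × ℚ → ℂ := fun q => ((q.1 : ℝ) : ℂ) + ((q.2 : ℝ) : ℂ) * Complex.I with hev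
  set F : ℕ → (ℚ × ℚ → Icc (0 : ℝ) 1) := fun n q =>
    ⟨h (φ₁ n) (nearestSite (δs (φ₁ n)) (ev q)), h01 _ _⟩ with hF
  obtain ⟨G, φ₂, hφ₂, hG⟩ := SeqCompactSpace.tendsto_subseq F
  set φ := φ₁ ∘ φ₂ with hφ
  have hφm : StrictMono φ := hφ₁.comp hφ₂
  refine ⟨φ, hφm, ⟨I, hI.comp hφ₂.tendsto_atTop⟩, ?_⟩
  -- notation for the interpolants along `φ`
  set a : ℕ → ℂ → ℝ := fun n w => h (φ n) (nearestSite (δs (φ n)) w) with ha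
  have ha01 : ∀ n w, a n w ∈ Icc (0 : ℝ) 1 := fun n w => h01 _ _
  have hδφ : Tendsto (fun n => δs (φ n)) atTop (𝓝 0) := hδ0.comp hφm.tendsto_atTop
  -- convergence at the rational points
  have hrat : ∀ q : ℚ × ℚ, Tendsto (fun n => a n (ev q)) atTop (𝓝 (G q : ℝ)) := by
    intro q
    have := (continuous_subtype_val.tendsto _).comp ((tendsto_pi_nhds.1 hG) q)
    exact this
  -- the equi-Lipschitz bound transferred to the subsequence and to interpolants
  have hL' : ∀ z ∈ Ω, ∃ r > 0, ∃ L ≥ (0 : ℝ), ∀ᶠ n in atTop, ∀ w w' : ℂ, w ∈ ball z r → w' ∈ ball z r →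
      |a n w - a n w'| ≤ L * (dist w w' + 2 * δs (φ n)) := by
    intro z hz
    obtain ⟨r, hr, L, hL0, hev'⟩ := hL z hz
    refine ⟨r / 2, by positivity, L, hL0, ?_⟩
    have h1 := hφm.tendsto_atTop.eventually hev'
    have h2 := (tendsto_order.1 hδφ).2 _ (half_pos hr)
    filter_upwards [h1, h2] with n hn hδn w w' hw hw'
    have hdw := dist_meshPoint_nearestSite_le (hδ (φ n)) w
    have hdw' := dist_meshPoint_nearestSite_le (hδ (φ n)) w'
    have hmw : meshPoint (δs (φ n)) (nearestSite (δs (φ n)) w) ∈ ball z r := by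
      rw [mem_ball] at hw ⊢
      linarith [dist_triangle (meshPoint (δs (φ n)) (nearestSite (δs (φ n)) w)) w z]
    have hmw' : meshPoint (δs (φ n)) (nearestSite (δs (φ n)) w') ∈ ball z r := by
      rw [mem_ball] at hw' ⊢
      linarith [dist_triangle (meshPoint (δs (φ n)) (nearestSite (δs (φ n)) w')) w' z]
    refine (hn _ _ hmw hmw').trans (mul_le_mul_of_nonneg_left ?_ hL0)
    linarith [dist_triangle4 (meshPoint (δs (φ n)) (nearestSite (δs (φ n)) w)) w w'
      (meshPoint (δs (φ n)) (nearestSite (δs (φ n)) w')), dist_comm w' (meshPoint (δs (φ n)) (nearestSite (δs (φ n)) w'))]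
  -- the sequence `a n w` is Cauchy for every `w ∈ Ω`
  have hcauchy : ∀ w ∈ Ω, CauchySeq fun n => a n w := by
    intro w hw
    obtain ⟨r, hr, L, hL0, hev'⟩ := hL' w hw
    rw [Metric.cauchySeq_iff]
    intro ε hε
    -- a rational point near `w`
    obtain ⟨q, hq⟩ := exists_rat_rat_dist_lt w (lt_min hr (show 0 < ε / (8 * (L + 1)) by positivity))
    have hqr : ev q ∈ ball w r := mem_ball.2 (hq.trans_le (min_le_left _ _))
    have hqε : dist (ev q) w < ε / (8 * (L + 1)) := hq.trans_le (min_le_right _ _)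
    have hq_cauchy := (hrat q).cauchySeq
    rw [Metric.cauchySeq_iff] at hq_cauchy
    obtain ⟨N₁, hN₁⟩ := hq_cauchy (ε / 4) (by positivity)
    obtain ⟨N₂, hN₂⟩ := eventually_atTop.1 (hev'.and ((tendsto_order.1 hδφ).2 _
      (show 0 < ε / (16 * (L + 1)) by positivity)))
    refine ⟨max N₁ N₂, fun m hm n hn => ?_⟩
    have hm2 := hN₂ m (le_of_max_le_right hm)
    have hn2 := hN₂ n (le_of_max_le_right hn)
    have e1 := hm2.1 w (ev q) (mem_ball_self hr) hqr
    have e2 := hn2.1 w (ev q) (mem_ball_self hr) hqr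
    have e3 := hN₁ m (le_of_max_le_left hm) n (le_of_max_le_left hn)
    rw [Real.dist_eq] at e3 ⊢
    have hd : dist w (ev q) ≤ ε / (8 * (L + 1)) := by rw [dist_comm]; exact hqε.le
    have hquart : (L + 1) * (ε / (8 * (L + 1)) + 2 * (ε / (16 * (L + 1)))) = ε / 4 := by
      field_simp; ring
    have hL1 : L * (dist w (ev q) + 2 * δs (φ m)) ≤ ε / 4 := by
      rw [← hquart]
      exact mul_le_mul (by linarith) (by linarith [hm2.2.le])
        (by linarith [dist_nonneg (x := w) (y := ev q), (hδ (φ m)).le]) (by linarith)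
    have hL2 : L * (dist w (ev q) + 2 * δs (φ n)) ≤ ε / 4 := by
      rw [← hquart]
      exact mul_le_mul (by linarith) (by linarith [hn2.2.le])
        (by linarith [dist_nonneg (x := w) (y := ev q), (hδ (φ n)).le]) (by linarith)
    have htri : |a m w - a n w| ≤
        |a m w - a m (ev q)| + |a m (ev q) - a n (ev q)| + |a n (ev q) - a n w| := by
      calc |a m w - a n w| = |(a m w - a m (ev q)) + (a m (ev q) - a n (ev q)) + (a n (ev q) - a n w)| := by
            ring_nf
        _ ≤ _ := abs_add_three _ _ _
    have e2' : |a n (ev q) - a n w| ≤ L * (dist w (ev q) + 2 * δs (φ n)) := by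
      rw [abs_sub_comm]; exact e2
    linarith
  -- the limit, clamped to `[0, 1]` off `Ω`
  set v : ℂ → ℝ := fun w => max 0 (min 1 (limUnder atTop fun n => a n w)) with hv
  have hvlim : ∀ w ∈ Ω, Tendsto (fun n => a n w) atTop (𝓝 (v w)) := by
    intro w hw
    have ht := (cauchySeq_tendsto_of_complete (hcauchy w hw)).choose_spec
    have heq : limUnder atTop (fun n => a n w) = (cauchySeq_tendsto_of_complete (hcauchy w hw)).choose :=
      ht.limUnder_eq
    have hmem : (cauchySeq_tendsto_of_complete (hcauchy w hw)).choose ∈ Icc (0 : ℝ) 1 :=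
      isClosed_Icc.mem_of_tendsto ht (Eventually.of_forall fun n => ha01 n w)
    have hvw : v w = (cauchySeq_tendsto_of_complete (hcauchy w hw)).choose := by
      rw [hv]; simp only; rw [heq, min_eq_right hmem.2, max_eq_right hmem.1]
    rw [hvw]; exact ht
  refine ⟨v, fun w => ⟨le_max_left _ _, max_le zero_le_one (min_le_left _ _)⟩, fun z hz => ?_⟩
  obtain ⟨r, hr, L, hL0, hev'⟩ := hL' z hz
  have hballΩ : ∃ r' > 0, r' ≤ r ∧ ball z r' ⊆ Ω := by
    obtain ⟨r', hr', hsub⟩ := Metric.isOpen_iff.1 hΩo z hz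
    exact ⟨min r r', by positivity, min_le_left _ _, (ball_subset_ball (min_le_right _ _)).trans hsub⟩
  obtain ⟨r', hr', hr'r, hsub⟩ := hballΩ
  refine ⟨r' / 2, by positivity, ⟨L, hL0, fun w hw w' hw' => ?_⟩, ?_⟩
  · -- Lipschitz bound in the limit
    have hwΩ : w ∈ Ω := hsub (ball_subset_ball (by linarith) hw)
    have hw'Ω : w' ∈ Ω := hsub (ball_subset_ball (by linarith) hw')
    have hwr : w ∈ ball z r := ball_subset_ball (by linarith) hw
    have hw'r : w' ∈ ball z r := ball_subset_ball (by linarith) hw'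
    have hlim := ((hvlim w hwΩ).sub (hvlim w' hw'Ω)).abs
    have hbound : Tendsto (fun n => L * (dist w w' + 2 * δs (φ n))) atTop (𝓝 (L * (dist w w' + 2 * 0))) :=
      (tendsto_const_nhds.add (tendsto_const_nhds.mul hδφ)).const_mul L
    rw [mul_zero, add_zero] at hbound
    exact le_of_tendsto_of_tendsto hlim hbound (hev'.mono fun n hn => hn w w' hwr hw'r)
  · -- uniform convergence on the small ball: finite net of rational points
    rw [Metric.tendstoUniformlyOn_iff]
    intro ε hε
    set η : ℝ := min (r' / 4) (ε / (8 * (L + 1))) with hη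
    have hη0 : 0 < η := by positivity
    -- cover the compact closed ball of radius `r'/2` by `η`-balls around rational points
    obtain ⟨Qs, hQs⟩ := (isCompact_closedBall z (r' / 2)).elim_finite_subcover
      (fun q : ℚ × ℚ => ball (ev q) η) (fun _ => isOpen_ball) (fun w _ => by
        obtain ⟨q, hq⟩ := exists_rat_rat_dist_lt w hη0
        exact mem_iUnion.2 ⟨q, mem_ball.2 (by rwa [dist_comm])⟩)
    -- keep only the rational points close to the ball (they are in `Ω` and in `ball z r`)
    have hconv : ∀ᶠ n in atTop, ∀ q ∈ Qs, ev q ∈ ball z (3 * r' / 4) → |a n (ev q) - v (ev q)| < ε / 4 := by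
      refine Qs.eventually_all.2 fun q _ => ?_
      by_cases hq' : ev q ∈ ball z (3 * r' / 4)
      · have hqΩ : ev q ∈ Ω := hsub (ball_subset_ball (by linarith) hq')
        have := (Metric.tendsto_nhds.1 (hvlim _ hqΩ)) (ε / 4) (by positivity)
        exact this.mono fun n hn _ => by rwa [Real.dist_eq] at hn
      · exact Eventually.of_forall fun n h => absurd h hq'
    have hδev := (tendsto_order.1 hδφ).2 _ hη0
    filter_upwards [hconv, hev', hδev] with n hn hLn hδn w hw
    -- a net point near `w`
    have hw' : w ∈ closedBall z (r' / 2) := ball_subset_closedBall hw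
    obtain ⟨q, hqQ, hwq⟩ : ∃ q ∈ Qs, w ∈ ball (ev q) η := by
      simpa only [mem_iUnion, exists_prop] using hQs hw'
    have hwq' : dist w (ev q) < η := mem_ball.1 hwq
    have hq3 : ev q ∈ ball z (3 * r' / 4) := by
      rw [mem_ball]
      calc dist (ev q) z ≤ dist (ev q) w + dist w z := dist_triangle _ _ _
        _ < η + r' / 2 := add_lt_add (by rwa [dist_comm]) (mem_ball.1 hw)
        _ ≤ r' / 4 + r' / 2 := by gcongr; exact min_le_left _ _
        _ = 3 * r' / 4 := by ring
    have hqr : ev q ∈ ball z r := ball_subset_ball (by linarith) hq3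
    have hwr : w ∈ ball z r := ball_subset_ball (by linarith) hw
    have hwΩ : w ∈ Ω := hsub (ball_subset_ball (by linarith) hw)
    have hqΩ : ev q ∈ Ω := hsub (ball_subset_ball (by linarith) hq3)
    have e1 : |a n w - a n (ev q)| ≤ L * (dist w (ev q) + 2 * δs (φ n)) := hLn w (ev q) hwr hqr
    have e2 : |a n (ev q) - v (ev q)| < ε / 4 := hn q hqQ hq3
    -- Lipschitz bound of `v` between `w` and `ev q` (both in `ball z r`, limits exist)
    have e3 : |v w - v (ev q)| ≤ L * dist w (ev q) := by
      have hlim := ((hvlim w hwΩ).sub (hvlim _ hqΩ)).abs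
      have hbound : Tendsto (fun n => L * (dist w (ev q) + 2 * δs (φ n))) atTop
          (𝓝 (L * (dist w (ev q) + 2 * 0))) :=
        (tendsto_const_nhds.add (tendsto_const_nhds.mul hδφ)).const_mul L
      rw [mul_zero, add_zero] at hbound
      exact le_of_tendsto_of_tendsto hlim hbound (hev'.mono fun n hn => hn w (ev q) hwr hqr)
    have hηε : η ≤ ε / (8 * (L + 1)) := min_le_right _ _
    have h8 : (L + 1) * (ε / (8 * (L + 1))) = ε / 8 := by field_simp
    have hb1 : L * (dist w (ev q) + 2 * δs (φ n)) ≤ 3 * ε / 8 := by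
      have : L * (dist w (ev q) + 2 * δs (φ n)) ≤ (L + 1) * (3 * (ε / (8 * (L + 1)))) :=
        mul_le_mul (by linarith) (by linarith [hwq'.le, hδn.le])
          (by linarith [dist_nonneg (x := w) (y := ev q), (hδ (φ n)).le]) (by linarith)
      linarith
    have hb3 : L * dist w (ev q) ≤ ε / 8 := by
      rw [← h8]
      exact mul_le_mul (by linarith) (by linarith [hwq'.le]) dist_nonneg (by linarith)
    rw [Real.dist_eq, abs_sub_comm]
    have htri : |a n w - v w| ≤ |a n w - a n (ev q)| + |a n (ev q) - v (ev q)| + |v (ev q) - v w| := by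
      calc |a n w - v w| = |(a n w - a n (ev q)) + (a n (ev q) - v (ev q)) + (v (ev q) - v w)| := by ring_nf
        _ ≤ _ := abs_add_three _ _ _
    have e3' : |v (ev q) - v w| ≤ L * dist w (ev q) := by rw [abs_sub_comm]; exact e3
    linarith

end Limits

/-! ### §7. No circuits around exterior faces, and boundary values of the potential ([GP19], Lemma 4.8) -/

section NoCircuit

variable {a : Site 2}

/-- **Winding of a closed walk across a face step.** For a closed lattice walk, the winding
numbers about two side-adjacent faces agree as soon as the walk does not traverse the primal
edge separating them (for closed walks no endpoint condition is needed; compare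
`Percolation.walkWinding_eq_of_faceWalk`). [folklore] -/
theorem walkWinding_closed_eq_of_sepEdge_notMem (p : (zdGraph 2).Walk a a) {z z' : Site 2}
    (hzz' : (zdGraph 2).Adj z z') (he : Percolation.sepEdge z z' ∉ p.edges) :
    Percolation.walkWinding p z = Percolation.walkWinding p z' := by
  have up_case : ∀ {w : Site 2},
      s(w + Pi.single 1 1, w + Pi.single 1 1 + Pi.single 0 1) ∉ p.edges →
      Percolation.walkWinding p w = Percolation.walkWinding p (w + Pi.single 1 1) := by
    intro w hw
    have hsum : (p.darts.map fun d => Percolation.hCross w d.fst d.snd).sum = 0 := by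
      refine List.sum_eq_zero fun t ht => ?_
      obtain ⟨d, hd, rfl⟩ := List.mem_map.1 ht
      refine Percolation.hCross_eq_zero_of_ne fun heq => hw ?_
      rw [← heq]
      exact List.mem_map.2 ⟨d, hd, rfl⟩
    have key := Percolation.walkWinding_sub_walkWinding_up p w
    rw [hsum] at key
    simp only [sub_self, neg_zero] at key
    linarith
  rcases Percolation.stepKind_of_adj hzz' with ⟨h0, h1⟩ | ⟨h0, h1⟩ | ⟨h1, h0⟩ | ⟨h1, h0⟩
  · have hz'eq : z' = z + Pi.single 0 1 := by simp [Site.eq_iff_two, h0, h1]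
    rw [hz'eq] at he ⊢
    rw [Percolation.sepEdge_right] at he
    exact Percolation.walkWinding_eq_walkWinding_right he
  · have hzeq : z = z' + Pi.single 0 1 := by simp [Site.eq_iff_two, h0, h1]
    rw [hzeq] at he ⊢
    rw [Percolation.sepEdge_comm, Percolation.sepEdge_right] at he
    exact (Percolation.walkWinding_eq_walkWinding_right he).symm
  · have hz'eq : z' = z + Pi.single 1 1 := by simp [Site.eq_iff_two, h0, h1]
    rw [hz'eq] at he ⊢
    rw [Percolation.sepEdge_up] at he
    exact up_case he
  · have hzeq : z = z' + Pi.single 1 1 := by simp [Site.eq_iff_two, h0, h1]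
    rw [hzeq] at he ⊢
    rw [Percolation.sepEdge_comm, Percolation.sepEdge_up] at he
    exact (up_case he).symm

/-- **Winding of a closed walk along a face walk.** If `q` is a walk of faces such that the
closed walk `p` never traverses the primal edge separating two consecutive faces of `q`, then
`p` winds equally about the two end faces of `q`. [folklore] -/
theorem walkWinding_closed_eq_of_faceWalk (p : (zdGraph 2).Walk a a) {c d : Site 2}
    (q : (zdGraph 2).Walk c d) (hq : ∀ dq ∈ q.darts, Percolation.sepEdge dq.fst dq.snd ∉ p.edges) :
    Percolation.walkWinding p c = Percolation.walkWinding p d := by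
  induction q with
  | nil => rfl
  | cons h q ih =>
    rename_i x y z
    rw [walkWinding_closed_eq_of_sepEdge_notMem p h (hq ⟨(x, y), h⟩ (by simp))]
    exact ih fun dq hdq => hq dq (by simp [hdq])

/-- One more unit numerator changes a floor quotient by `0` or `1`, and in the latter case the new
numerator is a multiple of the (positive) divisor. [folklore] -/
theorem ediv_add_one_cases (x : ℤ) {D : ℤ} (hD : 0 < D) :
    (x + 1) / D = x / D ∨ ((x + 1) / D = x / D + 1 ∧ x + 1 = D * ((x + 1) / D)) := by
  have h1 : x / D ≤ (x + 1) / D := Int.ediv_le_ediv hD (by linarith)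
  have h2 : (x + 1) / D ≤ x / D + 1 := by
    have : (x + 1) / D ≤ (x + 1 * D) / D := Int.ediv_le_ediv hD (by linarith)
    rwa [Int.add_mul_ediv_right _ _ hD.ne'] at this
  have ex := Int.mul_ediv_add_emod x D
  have ex1 := Int.mul_ediv_add_emod (x + 1) D
  have r1 := Int.emod_lt_of_pos x hD
  have s0 := Int.emod_nonneg (x + 1) hD.ne'
  rcases (show (x + 1) / D = x / D ∨ (x + 1) / D = x / D + 1 by omega) with h | h
  · exact Or.inl h
  · refine Or.inr ⟨h, ?_⟩
    rw [h, mul_add, mul_one] at ex1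
    have hzero : (x + 1) % D = 0 := le_antisymm (by linarith) s0
    rw [h, mul_add, mul_one]
    linarith

/-- Floor quotient bounds: `D · (x / D) ≤ x < D · (x / D) + D`. [folklore] -/
theorem mul_ediv_le_and_lt (x : ℤ) {D : ℤ} (hD : 0 < D) :
    D * (x / D) ≤ x ∧ x < D * (x / D) + D := by
  have ex := Int.mul_ediv_add_emod x D
  have r0 := Int.emod_nonneg x hD.ne'
  have r1 := Int.emod_lt_of_pos x hD
  constructor <;> linarith

/-- A point of a vertical segment, given by its height fraction. [folklore] -/
theorem mem_segment_vertical {X Y₀ Y₁ Y : ℝ} (h0 : Y₀ ≤ Y) (h1 : Y ≤ Y₁) (hlt : Y₀ < Y₁) :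
    (⟨X, Y⟩ : ℂ) ∈ segment ℝ (⟨X, Y₀⟩ : ℂ) ⟨X, Y₁⟩ := by
  set θ := (Y - Y₀) / (Y₁ - Y₀) with hθ
  have hne : Y₁ - Y₀ ≠ 0 := by linarith
  have hθ0 : 0 ≤ θ := div_nonneg (by linarith) (by linarith)
  have hθ1 : θ ≤ 1 := (div_le_one (by linarith)).2 (by linarith)
  refine ⟨1 - θ, θ, by linarith, hθ0, by ring, ?_⟩
  apply Complex.ext
  · simp only [Complex.add_re, Complex.smul_re, smul_eq_mul]; ring
  · simp only [Complex.add_im, Complex.smul_im, smul_eq_mul]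
    rw [hθ]; field_simp; ring

/-- A point of a horizontal segment, given by its abscissa fraction. [folklore] -/
theorem mem_segment_horizontal {X₀ X₁ X Y : ℝ} (h0 : X₀ ≤ X) (h1 : X ≤ X₁) (hlt : X₀ < X₁) :
    (⟨X, Y⟩ : ℂ) ∈ segment ℝ (⟨X₀, Y⟩ : ℂ) ⟨X₁, Y⟩ := by
  set θ := (X - X₀) / (X₁ - X₀) with hθ
  have hne : X₁ - X₀ ≠ 0 := by linarith
  have hθ0 : 0 ≤ θ := div_nonneg (by linarith) (by linarith)
  have hθ1 : θ ≤ 1 := (div_le_one (by linarith)).2 (by linarith)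
  refine ⟨1 - θ, θ, by linarith, hθ0, by ring, ?_⟩
  apply Complex.ext
  · simp only [Complex.add_re, Complex.smul_re, smul_eq_mul]
    rw [hθ]; field_simp; ring
  · simp only [Complex.add_im, Complex.smul_im, smul_eq_mul]; ring

/-- **Crossing a coarse vertical edge.** If a fine lattice point `x'` (fine mesh `δ / D`) has
abscissa `D (f₀ + 1)` and ordinate in the `f₁`-th coarse row, its mesh point lies on the coarse
vertical edge from `δ (f₀ + 1, f₁)` to `δ (f₀ + 1, f₁ + 1)`. [folklore] -/
theorem meshPoint_fine_mem_segment_vertical {δ : ℝ} (hδ : 0 < δ) {D : ℤ} (hD : 0 < D)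
    (x' f : Site 2) (h0 : x' 0 = D * (f 0 + 1)) (h1 : f 1 = x' 1 / D) :
    meshPoint (δ / D) x' ∈ segment ℝ (meshPoint δ (f + Pi.single 0 1))
      (meshPoint δ (f + Pi.single 0 1 + Pi.single 1 1)) := by
  have hDr : (0 : ℝ) < D := by exact_mod_cast hD
  obtain ⟨hl, hu⟩ := mul_ediv_le_and_lt (x' 1) hD
  rw [← h1] at hl hu
  have hX : δ / D * (x' 0 : ℝ) = δ * (((f + Pi.single 0 1 : Site 2) 0 : ℤ) : ℝ) := by
    rw [h0]; push_cast; simp; field_simp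
  have hmk : ∀ y : Site 2, ∀ η : ℝ, meshPoint η y = ⟨η * y 0, η * y 1⟩ := fun y η =>
    Complex.ext (by simp) (by simp)
  rw [hmk, hmk, hmk, hX]
  have e1 : ((f + Pi.single 0 1 + Pi.single 1 1 : Site 2) 0 : ℤ) = (f + Pi.single 0 1 : Site 2) 0 := by simp
  have e2 : (((f + Pi.single 0 1 : Site 2) 1 : ℤ) : ℝ) = f 1 := by simp
  have e3 : (((f + Pi.single 0 1 + Pi.single 1 1 : Site 2) 1 : ℤ) : ℝ) = f 1 + 1 := by simp
  rw [e1, e2, e3]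
  refine mem_segment_vertical ?_ ?_ (by nlinarith)
  · rw [div_mul_eq_mul_div, le_div_iff₀ hDr]
    have : (D : ℝ) * (f 1 : ℝ) ≤ x' 1 := by exact_mod_cast hl
    nlinarith
  · rw [div_mul_eq_mul_div, div_le_iff₀ hDr]
    have : (x' 1 : ℝ) ≤ D * (f 1 : ℝ) + D := by exact_mod_cast hu.le
    nlinarith

/-- **Crossing a coarse horizontal edge** (the transposed statement). [folklore] -/
theorem meshPoint_fine_mem_segment_horizontal {δ : ℝ} (hδ : 0 < δ) {D : ℤ} (hD : 0 < D)
    (x' f : Site 2) (h1 : x' 1 = D * (f 1 + 1)) (h0 : f 0 = x' 0 / D) :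
    meshPoint (δ / D) x' ∈ segment ℝ (meshPoint δ (f + Pi.single 1 1))
      (meshPoint δ (f + Pi.single 1 1 + Pi.single 0 1)) := by
  have hDr : (0 : ℝ) < D := by exact_mod_cast hD
  obtain ⟨hl, hu⟩ := mul_ediv_le_and_lt (x' 0) hD
  rw [← h0] at hl hu
  have hY : δ / D * (x' 1 : ℝ) = δ * (((f + Pi.single 1 1 : Site 2) 1 : ℤ) : ℝ) := by
    rw [h1]; push_cast; simp; field_simp
  have hmk : ∀ y : Site 2, ∀ η : ℝ, meshPoint η y = ⟨η * y 0, η * y 1⟩ := fun y η =>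
    Complex.ext (by simp) (by simp)
  rw [hmk, hmk, hmk, hY]
  have e1 : ((f + Pi.single 1 1 + Pi.single 0 1 : Site 2) 1 : ℤ) = (f + Pi.single 1 1 : Site 2) 1 := by simp
  have e2 : (((f + Pi.single 1 1 : Site 2) 0 : ℤ) : ℝ) = f 0 := by simp
  have e3 : (((f + Pi.single 1 1 + Pi.single 0 1 : Site 2) 0 : ℤ) : ℝ) = f 0 + 1 := by simp
  rw [e1, e2, e3]
  refine mem_segment_horizontal ?_ ?_ (by nlinarith)
  · rw [div_mul_eq_mul_div, le_div_iff₀ hDr]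
    have : (D : ℝ) * (f 0 : ℝ) ≤ x' 0 := by exact_mod_cast hl
    nlinarith
  · rw [div_mul_eq_mul_div, div_le_iff₀ hDr]
    have : (x' 0 : ℝ) ≤ D * (f 0 : ℝ) + D := by exact_mod_cast hu.le
    nlinarith

/-- **From a fine walk in `E` to a coarse face walk.** A walk of the fine lattice (mesh `δ/D`)
whose closed edges lie in `E` is shadowed by a walk of coarse faces (lower-left corners
`⌊x/D⌋`), consecutive faces being separated by a coarse edge (mesh `δ`) that contains a point
of `E` — namely the fine vertex at which the fine walk crosses the coarse grid line.
[folklore] -/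
theorem exists_faceWalk_of_fineWalk {E : Set ℂ} {δ : ℝ} (hδ : 0 < δ) {D : ℤ} (hD : 0 < D) :
    ∀ {x y : Site 2}, (innerGraph E (δ / D)).Walk x y →
      ∃ q : (zdGraph 2).Walk (fun i => x i / D) (fun i => y i / D),
        ∀ dq ∈ q.darts, ∃ w ∈ segment ℝ (meshPoint δ (Percolation.sepLo dq.fst dq.snd))
          (meshPoint δ (Percolation.sepHi dq.fst dq.snd)), w ∈ E := by
  intro x y w
  induction w with
  | nil => exact ⟨SimpleGraph.Walk.nil, by simp⟩
  | cons hxx' w ih =>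
    rename_i x x' y'
    -- abbreviations for the two coarse faces
    set f : Site 2 := fun i => x i / D with hf
    set f' : Site 2 := fun i => x' i / D with hf'
    obtain ⟨q, hq⟩ := ih
    obtain ⟨hzd, hseg⟩ := innerGraph_adj_iff.1 hxx'
    have hxE : meshPoint (δ / D) x ∈ E := hseg (left_mem_segment ℝ _ _)
    have hx'E : meshPoint (δ / D) x' ∈ E := hseg (right_mem_segment ℝ _ _)
    -- helper: conclude when the faces coincide
    have same : f = f' → ∃ q : (zdGraph 2).Walk f (fun i => y' i / D),
        ∀ dq ∈ q.darts, ∃ w ∈ segment ℝ (meshPoint δ (Percolation.sepLo dq.fst dq.snd))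
          (meshPoint δ (Percolation.sepHi dq.fst dq.snd)), w ∈ E := by
      intro h; rw [h]; exact ⟨q, hq⟩
    -- helper: conclude with one extra face step whose separating edge contains `w₀ ∈ E`
    have step : ∀ (hadj : (zdGraph 2).Adj f f') (w₀ : ℂ), w₀ ∈ E →
        w₀ ∈ segment ℝ (meshPoint δ (Percolation.sepLo f f')) (meshPoint δ (Percolation.sepHi f f')) →
        ∃ q : (zdGraph 2).Walk f (fun i => y' i / D),
        ∀ dq ∈ q.darts, ∃ w ∈ segment ℝ (meshPoint δ (Percolation.sepLo dq.fst dq.snd))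
          (meshPoint δ (Percolation.sepHi dq.fst dq.snd)), w ∈ E := by
      intro hadj w₀ hw₀ hw₀s
      refine ⟨SimpleGraph.Walk.cons hadj q, fun dq hdq => ?_⟩
      rw [SimpleGraph.Walk.darts_cons, List.mem_cons] at hdq
      rcases hdq with rfl | hdq
      · exact ⟨w₀, hw₀s, hw₀⟩
      · exact hq dq hdq
    rcases Percolation.stepKind_of_adj hzd with ⟨h0, h1⟩ | ⟨h0, h1⟩ | ⟨h1, h0⟩ | ⟨h1, h0⟩
    · -- right step `x' = x + e₀`
      have hf1 : f' 1 = f 1 := by simp [hf, hf', h1]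
      rcases ediv_add_one_cases (x 0) hD with hc | ⟨hc, hmul⟩
      · exact same (by ext i; fin_cases i <;> simp [hf, hf', h0, h1, hc])
      · have hff' : f' = f + Pi.single 0 1 := by
          ext i; fin_cases i
          · simp [hf, hf', h0, hc]
          · simpa using hf1
        have hadj : (zdGraph 2).Adj f f' := by rw [hff']; exact zdGraph_adj_add_single f 0 (Or.inl rfl)
        refine step hadj _ hx'E ?_
        rw [hff', Percolation.sepLo_add_e0, Percolation.sepHi_add_e0]
        refine meshPoint_fine_mem_segment_vertical hδ hD x' f ?_ (by simp [hf, h1])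
        rw [h0, hmul, hc]
      -- (the `rw` above closes the goal since `f 0 = x 0 / D`)
    · -- left step `x = x' + e₀`
      have hf1 : f' 1 = f 1 := by simp [hf, hf', h1]
      rcases ediv_add_one_cases (x' 0) hD with hc | ⟨hc, hmul⟩
      · exact same (by ext i; fin_cases i <;> simp [hf, hf', h0, h1, hc])
      · have hff' : f = f' + Pi.single 0 1 := by
          ext i; fin_cases i
          · simp [hf, hf', h0, hc]
          · simpa using hf1.symm
        have hadj : (zdGraph 2).Adj f f' := by
          rw [hff']; exact (zdGraph_adj_add_single f' 0 (Or.inl rfl)).symm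
        refine step hadj _ hxE ?_
        rw [hff', Percolation.sepLo_comm, Percolation.sepHi_comm, Percolation.sepLo_add_e0,
          Percolation.sepHi_add_e0]
        refine meshPoint_fine_mem_segment_vertical hδ hD x f' ?_ (by simp [hf', h1])
        rw [h0, hmul, hc]
    · -- up step `x' = x + e₁`
      have hf0 : f' 0 = f 0 := by simp [hf, hf', h0]
      rcases ediv_add_one_cases (x 1) hD with hc | ⟨hc, hmul⟩
      · exact same (by ext i; fin_cases i <;> simp [hf, hf', h0, h1, hc])
      · have hff' : f' = f + Pi.single 1 1 := by
          ext i; fin_cases i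
          · simpa using hf0
          · simp [hf, hf', h1, hc]
        have hadj : (zdGraph 2).Adj f f' := by rw [hff']; exact zdGraph_adj_add_single f 1 (Or.inl rfl)
        refine step hadj _ hx'E ?_
        rw [hff', Percolation.sepLo_add_e1, Percolation.sepHi_add_e1]
        refine meshPoint_fine_mem_segment_horizontal hδ hD x' f ?_ (by simp [hf, h0])
        rw [h1, hmul, hc]
    · -- down step `x = x' + e₁`
      have hf0 : f' 0 = f 0 := by simp [hf, hf', h0]
      rcases ediv_add_one_cases (x' 1) hD with hc | ⟨hc, hmul⟩
      · exact same (by ext i; fin_cases i <;> simp [hf, hf', h0, h1, hc])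
      · have hff' : f = f' + Pi.single 1 1 := by
          ext i; fin_cases i
          · simpa using hf0.symm
          · simp [hf, hf', h1, hc]
        have hadj : (zdGraph 2).Adj f f' := by
          rw [hff']; exact (zdGraph_adj_add_single f' 1 (Or.inl rfl)).symm
        refine step hadj _ hxE ?_
        rw [hff', Percolation.sepLo_comm, Percolation.sepHi_comm, Percolation.sepLo_add_e1,
          Percolation.sepHi_add_e1]
        refine meshPoint_fine_mem_segment_horizontal hδ hD x f' ?_ (by simp [hf', h0])
        rw [h1, hmul, hc]

/-- Floor of a floor: `⌊⌊t D⌋ / D⌋ = ⌊t⌋` for a positive integer `D` (integer division).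
[folklore] -/
theorem floor_mul_ediv {t : ℝ} {D : ℤ} (hD : 0 < D) : ⌊t * D⌋ / D = ⌊t⌋ := by
  have hDr : (0 : ℝ) < D := by exact_mod_cast hD
  set k := ⌊t⌋ with hk
  have h1 : (k : ℝ) ≤ t := Int.floor_le t
  have h2 : t < k + 1 := Int.lt_floor_add_one t
  have hlo : k * D ≤ ⌊t * D⌋ := by
    rw [Int.le_floor]; push_cast; nlinarith
  have hhi : ⌊t * D⌋ < (k + 1) * D := by
    have : (⌊t * D⌋ : ℝ) ≤ t * D := Int.floor_le _
    have h3 : t * D < (k + 1) * D := by nlinarith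
    exact_mod_cast this.trans_lt h3
  refine le_antisymm ?_ ((Int.le_ediv_iff_mul_le hD).2 hlo)
  have := (Int.ediv_lt_iff_lt_mul hD).2 hhi
  omega

/-- The fine lattice point `⌊e D / δ⌋` (coordinatewise) has mesh point (fine mesh `δ / D`) within
`δ / D` of `e` in each coordinate, hence within `2 δ / D` of `e`. [folklore] -/
theorem dist_meshPoint_floor_le {δ : ℝ} (hδ : 0 < δ) {D : ℤ} (hD : 0 < D) (e : ℂ) :
    dist (meshPoint (δ / D) ![⌊e.re * D / δ⌋, ⌊e.im * D / δ⌋]) e ≤ 2 * (δ / D) := by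
  have hDr : (0 : ℝ) < D := by exact_mod_cast hD
  have hm : 0 < δ / D := div_pos hδ hDr
  have key : ∀ a : ℝ, |δ / D * (⌊a * D / δ⌋ : ℤ) - a| ≤ δ / D := by
    intro a
    have h1 := Int.floor_le (a * D / δ)
    have h2 := Int.lt_floor_add_one (a * D / δ)
    have ha : δ / D * (a * D / δ) = a := by field_simp
    rw [abs_le]
    constructor <;> nlinarith
  rw [Complex.dist_eq]
  refine (Complex.norm_le_abs_re_add_abs_im _).trans ?_
  have h0 := key e.re
  have h1 := key e.im
  simp only [Complex.sub_re, Complex.sub_im, meshPoint_re, meshPoint_im, Matrix.cons_val_zero,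
    Matrix.cons_val_one] at h0 h1 ⊢
  linarith

/-- The coarse face of the fine floor point of `e` is the coarse floor face of `e`. [folklore] -/
theorem floor_fine_ediv {δ : ℝ} {D : ℤ} (hD : 0 < D) (e : ℂ) :
    (fun i => (![⌊e.re * D / δ⌋, ⌊e.im * D / δ⌋] : Site 2) i / D) = ![⌊e.re / δ⌋, ⌊e.im / δ⌋] := by
  have h0 : ⌊e.re * D / δ⌋ / D = ⌊e.re / δ⌋ := by
    rw [show e.re * D / δ = e.re / δ * D by ring]; exact floor_mul_ediv hD
  have h1 : ⌊e.im * D / δ⌋ / D = ⌊e.im / δ⌋ := by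
    rw [show e.im * D / δ = e.im / δ * D by ring]; exact floor_mul_ediv hD
  funext i
  fin_cases i
  · exact h0
  · exact h1

open WeakBeurling in
/-- **No circuits of inner edges around an exterior face.** Let `Ω` be bounded with open
connected exterior `E = (closure Ω)ᶜ` (e.g. a Jordan domain, by the Jordan curve theorem), let
`e₀ ∈ E` and let `p = ⌊e₀ / δ⌋` be the coarse face containing it. Then every closed lattice walk
all of whose steps are inner edges of `Ω` at mesh `δ` (closed segments inside `Ω`) has winding
number `0` about (the centre of) the face `p`: a fine lattice path inside `E` from `e₀` to a far
exterior point (bulk lemma in `E`) is shadowed by a walk of coarse faces whose separating edges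
contain exterior points, hence are not traversed (`exists_faceWalk_of_fineWalk`,
`walkWinding_closed_eq_of_faceWalk`), and far faces have winding `0`. [folklore] -/
theorem walkWinding_eq_zero_of_mem_exterior {Ω : Set ℂ} (hΩb : Bornology.IsBounded Ω)
    (hEc : IsConnected (closure Ω)ᶜ) {δ : ℝ} (hδ : 0 < δ)
    {e₀ : ℂ} (he₀ : e₀ ∈ (closure Ω)ᶜ) {c : Site 2} (W : (zdGraph 2).Walk c c)
    (hW : ∀ dw ∈ W.darts, (innerGraph Ω δ).Adj dw.fst dw.snd) :
    Percolation.walkWinding W ![⌊e₀.re / δ⌋, ⌊e₀.im / δ⌋] = 0 := by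
  classical
  have hEo : IsOpen (closure Ω)ᶜ := isClosed_closure.isOpen_compl
  -- trivial walk (e.g. when `Ω = ∅`)
  by_cases hdn : W.darts = []
  · simp [Percolation.walkWinding, hdn]
  obtain ⟨dw₀, hdw₀⟩ := List.exists_mem_of_ne_nil W.darts hdn
  set E : Set ℂ := (closure Ω)ᶜ with hE
  have hEne : Eᶜ.Nonempty := by
    rw [hE, compl_compl]
    exact ⟨_, subset_closure ((innerGraph_adj_iff.1 (hW dw₀ hdw₀)).2 (left_mem_segment ℝ _ _))⟩
  set p : Site 2 := ![⌊e₀.re / δ⌋, ⌊e₀.im / δ⌋] with hp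
  -- a box around `p` containing the walk
  obtain ⟨Rw, hRw⟩ : ∃ Rw : ℕ, ∀ z ∈ W.support, z ∈ sqBox p Rw := by
    obtain ⟨N, hN⟩ := Finset.exists_le (W.support.toFinset.image fun z => max |z 0 - p 0| |z 1 - p 1|)
    refine ⟨N.toNat, fun z hz => ?_⟩
    have := hN _ (Finset.mem_image_of_mem _ (List.mem_toFinset.2 hz))
    rw [mem_sqBox]
    constructor <;> omega
  -- a far exterior point on the real axis
  obtain ⟨ρ₀, hρ₀⟩ := (isBounded_iff_subset_closedBall (0 : ℂ)).1 hΩb.closure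
  set X : ℝ := max ρ₀ 0 + 1 + δ * ((Rw : ℝ) + |(p 0 : ℝ)| + 2) with hX
  set e₁ : ℂ := (X : ℂ) with he₁
  have hδpos : (0 : ℝ) ≤ δ * ((Rw : ℝ) + |(p 0 : ℝ)| + 2) := by positivity
  have he₁E : e₁ ∈ E := by
    intro h
    have := hρ₀ h
    rw [mem_closedBall, dist_zero_right, he₁, Complex.norm_real, Real.norm_eq_abs] at this
    have : X ≤ ρ₀ := (le_abs_self X).trans this
    linarith [le_max_left ρ₀ 0]
  -- the floor face of `e₁` is outside the box
  have hfar : (![⌊e₁.re / δ⌋, ⌊e₁.im / δ⌋] : Site 2) ∉ sqBox p Rw := by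
    rw [mem_sqBox, not_and_or]
    left
    simp only [Matrix.cons_val_zero, he₁, Complex.ofReal_re, not_le]
    have h1 : X / δ - 1 < (⌊X / δ⌋ : ℝ) := Int.sub_one_lt_floor _
    have h2 : (Rw : ℝ) + |(p 0 : ℝ)| + 2 ≤ X / δ := by
      rw [le_div_iff₀ hδ, hX]
      nlinarith [le_max_right ρ₀ 0]
    have h3 : ((Rw : ℤ) : ℝ) + |(p 0 : ℝ)| + 1 < ⌊X / δ⌋ := by push_cast; linarith
    have h4 : (Rw : ℤ) + |p 0| < ⌊X / δ⌋ := by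
      have : (((Rw : ℤ) + |p 0| : ℤ) : ℝ) < (⌊X / δ⌋ : ℝ) := by push_cast; linarith
      exact_mod_cast this
    have := le_abs_self (p 0)
    rw [lt_abs]; left; omega
  -- a path in `E` from `e₀` to `e₁`, and the bulk of `E` around it
  have hj : JoinedIn E e₀ e₁ :=
    (hEo.isConnected_iff_isPathConnected.1 hEc).joinedIn e₀ he₀ e₁ he₁E
  set γ := hj.somePath with hγ
  have hKc : IsCompact (Set.range γ) := isCompact_range γ.continuous
  have hKE : Set.range γ ⊆ E := by rintro _ ⟨t, rfl⟩; exact hj.somePath_mem t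
  obtain ⟨V, hVo, hVc, hKV, -, ρ, hρ, hρV⟩ := exists_isOpen_isPreconnected_bulk hEo hEc hEne hKc hKE
  have hVE : ∀ w ∈ V, ball w ρ ⊆ E := fun w hw =>
    ball_infDist_compl_subset.trans' (ball_subset_ball (hρV w hw).le)
  have he₀V : e₀ ∈ V := hKV ⟨0, γ.source⟩
  have he₁V : e₁ ∈ V := hKV ⟨1, γ.target⟩
  obtain ⟨r₀, hr₀, hr₀V⟩ := Metric.isOpen_iff.1 hVo e₀ he₀V
  obtain ⟨r₁, hr₁, hr₁V⟩ := Metric.isOpen_iff.1 hVo e₁ he₁V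
  -- fine dyadic scale `δ / 2^m`
  have htend : Tendsto (fun m : ℕ => δ / 2 ^ m) atTop (𝓝 0) := by
    have := (tendsto_pow_atTop_nhds_zero_of_lt_one (r := (2 : ℝ)⁻¹) (by norm_num)
      (by norm_num)).const_mul δ
    rw [mul_zero] at this
    refine this.congr' (Eventually.of_forall fun m => ?_)
    simp [div_eq_mul_inv, inv_pow]
  have htarget : 0 < min (ρ / 3) (min r₀ r₁ / 2) := by positivity
  obtain ⟨m, hm⟩ := (eventually_atTop.1 ((tendsto_order.1 htend).2 _ htarget))
  have hm' := hm m le_rfl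
  set D : ℤ := 2 ^ m with hD
  have hD0 : 0 < D := by positivity
  have hDcast : (D : ℝ) = 2 ^ m := by rw [hD]; push_cast; ring
  have hfine : δ / D = δ / 2 ^ m := by rw [hDcast]
  have hfine_pos : 0 < δ / D := by rw [hfine]; positivity
  have hfineρ : 3 * (δ / D) ≤ ρ := by
    rw [hfine]; linarith [hm'.le.trans (min_le_left _ _)]
  have hfine₀ : 2 * (δ / D) < r₀ := by
    rw [hfine]
    have : δ / 2 ^ m < r₀ / 2 :=
      hm'.trans_le ((min_le_right _ _).trans (by linarith [min_le_left r₀ r₁]))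
    linarith
  have hfine₁ : 2 * (δ / D) < r₁ := by
    rw [hfine]
    have : δ / 2 ^ m < r₁ / 2 :=
      hm'.trans_le ((min_le_right _ _).trans (by linarith [min_le_right r₀ r₁]))
    linarith
  -- fine lattice points near `e₀`, `e₁`
  set x₀ : Site 2 := ![⌊e₀.re * D / δ⌋, ⌊e₀.im * D / δ⌋] with hx₀
  set x₁ : Site 2 := ![⌊e₁.re * D / δ⌋, ⌊e₁.im * D / δ⌋] with hx₁
  have hx₀V : meshPoint (δ / D) x₀ ∈ V :=
    hr₀V (mem_ball.2 ((dist_meshPoint_floor_le hδ hD0 e₀).trans_lt hfine₀))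
  have hx₁V : meshPoint (δ / D) x₁ ∈ V :=
    hr₁V (mem_ball.2 ((dist_meshPoint_floor_le hδ hD0 e₁).trans_lt hfine₁))
  obtain ⟨wf⟩ := innerGraph_reachable_of_mem_bulk hfine_pos hfineρ hVc hVE hx₀V hx₁V
  obtain ⟨q, hq⟩ := exists_faceWalk_of_fineWalk (E := E) hδ hD0 wf
  have h0 : (fun i => x₀ i / D) = p := floor_fine_ediv hD0 e₀
  have h1 : (fun i => x₁ i / D) = ![⌊e₁.re / δ⌋, ⌊e₁.im / δ⌋] := floor_fine_ediv hD0 e₁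
  set q' := q.copy h0 h1 with hq'def
  have hq' : ∀ dq ∈ q'.darts, ∃ w ∈ segment ℝ (meshPoint δ (Percolation.sepLo dq.fst dq.snd))
      (meshPoint δ (Percolation.sepHi dq.fst dq.snd)), w ∈ E := by
    intro dq hdq
    rw [hq'def, SimpleGraph.Walk.darts_copy] at hdq
    exact hq dq hdq
  -- separating edges of the face walk are not traversed by `W` (they contain exterior points)
  have hsep : ∀ dq ∈ q'.darts, Percolation.sepEdge dq.fst dq.snd ∉ W.edges := by
    intro dq hdq hmem
    obtain ⟨w, hw, hwE⟩ := hq' dq hdq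
    obtain ⟨dw, hdw, hedge⟩ := List.mem_map.1 hmem
    obtain ⟨-, hsegΩ⟩ := innerGraph_adj_iff.1 (hW dw hdw)
    have heq : s(dw.fst, dw.snd) = s(Percolation.sepLo dq.fst dq.snd, Percolation.sepHi dq.fst dq.snd) :=
      hedge
    rcases Sym2.eq_iff.1 heq with ⟨h1, h2⟩ | ⟨h1, h2⟩
    · rw [h1, h2] at hsegΩ
      exact hwE (subset_closure (hsegΩ hw))
    · rw [h1, h2, segment_symm] at hsegΩ
      exact hwE (subset_closure (hsegΩ hw))
  rw [walkWinding_closed_eq_of_faceWalk W q' hsep]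
  exact walkWinding_eq_zero_of_not_mem_sqBox (fun z hz => hRw z hz) hfar

end NoCircuit

/-! ### Boundary values of the potential near interior points of the Dirichlet arcs -/

section BoundaryValues

variable {Ω : Set ℂ} {δ : ℝ}

open Classical in
/-- At an interior vertex (all four lattice edges are edges of `Ω_n`) the harmonicity clause of
the potential is the vanishing of the lattice Laplacian. [cite: GeorgakopoulosPanagiotis2019, §3.2] -/
theorem latticeLaplacian_eq_zero_of_interior (hΩo : IsOpen Ω) {A A' : Set ℂ} {h : Site 2 → ℝ}
    (hharm : ∀ x, x ∉ arcVertices Ω δ A → x ∉ arcVertices Ω δ A' →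
      ∑ y ∈ ((zdGraph 2).neighborFinset x).filter (fun y => (domainGraph Ω δ).Adj x y),
        (h y - h x) = 0)
    {x : Site 2} (hx : ∀ k : Fin 4, (domainGraph Ω δ).Adj x (x + cornerUnit k)) :
    latticeLaplacian h x = 0 := by
  -- no lattice edge at `x` meets `∂Ω`
  have hnotb : x ∉ boundary Ω δ := by
    rintro ⟨-, y, hxy, w, hw, hwf⟩
    obtain ⟨k, rfl⟩ := WeakBeurling.exists_eq_add_cornerUnit_of_adj hxy
    have hin := (domainGraph_adj_iff.1 (hx k)).1
    have hwΩ : w ∈ Ω := (innerGraph_adj_iff.1 hin).2 hw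
    rw [hΩo.frontier_eq] at hwf
    exact hwf.2 hwΩ
  have hfilter : ((zdGraph 2).neighborFinset x).filter (fun y => (domainGraph Ω δ).Adj x y) =
      (zdGraph 2).neighborFinset x := by
    refine Finset.filter_true_of_mem fun y hy => ?_
    rw [SimpleGraph.mem_neighborFinset] at hy
    obtain ⟨k, rfl⟩ := WeakBeurling.exists_eq_add_cornerUnit_of_adj hy
    exact hx k
  have := hharm x (fun h => hnotb h.1) (fun h => hnotb h.1)
  rwa [hfilter, sum_neighborFinset_sub_eq_latticeLaplacian] at this

open WeakBeurling Classical in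
/-- **Boundary values of the potential near an interior point of a Dirichlet arc** ([GP19],
Lemma 4.8, here quantitatively and without Brownian motion: by the weak discrete Beurling
estimate of the tree, Smirnov 2010 Lemma B.2/B.3, applied to `1 - h` on the interior vertices of
`Ω_n`). Let `R` be a conformal rectangle with `0 ∈ Ω`, `q = R.boundary t` an interior point of
the arc `A = R.arc i`, and `ε > 0`. Then there are `r > 0` and `δ₀ > 0` such that for every mesh
`δ < δ₀` and every `h : ℤ² → [0, 1]` which is `1` on `A_n` and harmonic for `Ω_n` off
`A_n ∪ A'_n`, we have `h(x) ≥ 1 - ε` at every interior vertex `x` of `Ω_n` whose mesh point lies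
in `B(q, r)`. [cite: GeorgakopoulosPanagiotis2019, Lemma 4.8] -/
theorem exists_forall_one_sub_le (R : RandomPlanarGeometry.ConformalRectangle)
    (h0 : (0 : ℂ) ∈ R.carrier) (i : Fin 4) {t : ℝ} (ht : t ∈ Ioo (R.mark i) (R.nextMark i))
    (A' : Set ℂ) {ε : ℝ} (hε : 0 < ε) :
    ∃ r > 0, ∃ δ₀ > 0, ∀ δ, 0 < δ → δ < δ₀ → ∀ h : Site 2 → ℝ,
      (arcVertices R.carrier δ (R.arc i)).EqOn h 1 → (∀ x, h x ∈ Icc (0 : ℝ) 1) →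
      (∀ x, x ∉ arcVertices R.carrier δ (R.arc i) → x ∉ arcVertices R.carrier δ A' →
        ∑ y ∈ ((zdGraph 2).neighborFinset x).filter (fun y => (domainGraph R.carrier δ).Adj x y),
          (h y - h x) = 0) →
      ∀ x : Site 2, meshPoint δ x ∈ ball (R.boundary t) r →
        (∀ k : Fin 4, (domainGraph R.carrier δ).Adj x (x + cornerUnit k)) → 1 - ε ≤ h x := by
  set Ω := R.carrier with hΩdef
  set q := R.boundary t with hq
  -- the neighbourhood of `q` seeing only the arc `i`
  obtain ⟨rA, hrA, hrA1, hrA2⟩ := R.exists_pos_forall_mem_arc_of_dist_lt i ht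
  have hqf : q ∈ frontier Ω := R.arc_subset_frontier i (mem_image_of_mem _ (Ioo_subset_Icc_self ht))
  -- Beurling constants and the smallness parameter `θ`
  set C := beurlingConst with hC
  set β := beurlingExp with hβ
  have hC0 : 0 < C := beurlingConst_pos
  have hβ0 : 0 < β := beurlingExp_pos
  set s₀ : ℝ := min 1 ((ε / (2 * C)) ^ β⁻¹) with hs₀
  have hs₀pos : 0 < s₀ := lt_min one_pos (Real.rpow_pos_of_pos (by positivity) _)
  have hs₀le : C * s₀ ^ β < ε := by
    by_cases hcase : (ε / (2 * C)) ^ β⁻¹ ≤ 1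
    · have : s₀ = (ε / (2 * C)) ^ β⁻¹ := min_eq_right hcase
      rw [this, Real.rpow_inv_rpow (by positivity) hβ0.ne']
      have : C * (ε / (2 * C)) = ε / 2 := by field_simp
      linarith
    · have hs1 : s₀ = 1 := min_eq_left (not_le.1 hcase).le
      rw [hs1, Real.one_rpow, mul_one]
      -- `(ε / (2C))^{1/β} > 1` forces `ε / (2C) > 1`
      by_contra hle
      have h1 : ε / (2 * C) ≤ 1 := by
        rw [div_le_one (by positivity)]; linarith [not_lt.1 hle]
      exact hcase (Real.rpow_le_one (by positivity) h1 (by positivity))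
  set θ : ℝ := s₀ / 64 with hθ
  have hθpos : 0 < θ := by positivity
  have hθle : θ ≤ 1 / 64 := by
    have : s₀ ≤ 1 := min_le_left _ _
    rw [hθ]; linarith
  -- the radii
  refine ⟨θ * rA, by positivity, θ * rA, by positivity, fun δ hδ hδlt h hA h01 hharm x hx hxint => ?_⟩
  set r := θ * rA with hr
  have hrle : r ≤ rA / 64 := by rw [hr]; nlinarith
  -- an exterior point near `q` and its coarse face `p`
  obtain ⟨e₀, he₀, hed⟩ := Metric.mem_closure_iff.1 (R.frontier_subset_closure_exterior' hqf) r
    (by positivity)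
  set p : Site 2 := ![⌊e₀.re / δ⌋, ⌊e₀.im / δ⌋] with hp
  have hp0 : |δ * (p 0 : ℝ) - e₀.re| ≤ δ := by
    have e : p 0 = ⌊e₀.re / δ⌋ := rfl
    rw [e]
    have h1 := Int.floor_le (e₀.re / δ)
    have h2 := Int.lt_floor_add_one (e₀.re / δ)
    have : δ * (e₀.re / δ) = e₀.re := by field_simp
    rw [abs_le]; constructor <;> nlinarith
  have hp1 : |δ * (p 1 : ℝ) - e₀.im| ≤ δ := by
    have e : p 1 = ⌊e₀.im / δ⌋ := rfl
    rw [e]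
    have h1 := Int.floor_le (e₀.im / δ)
    have h2 := Int.lt_floor_add_one (e₀.im / δ)
    have : δ * (e₀.im / δ) = e₀.im := by field_simp
    rw [abs_le]; constructor <;> nlinarith
  -- radii in lattice units
  set Rb : ℕ := ⌊rA / (8 * δ)⌋₊ with hRb
  have hRb1 : rA / (8 * δ) - 1 < Rb := Nat.sub_one_lt_floor _
  have hRb2 : (Rb : ℝ) ≤ rA / (8 * δ) := Nat.floor_le (by positivity)
  set ρ : ℕ := ⌊2 * r / δ⌋₊ + 1 with hρ
  -- the interior vertex set `S`
  set S : Set (Site 2) := {y ∈ domain Ω δ | ∀ k : Fin 4, (domainGraph Ω δ).Adj y (y + cornerUnit k)}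
    with hS
  have hSfin : S.Finite := (domain_finite R.isBounded hδ).subset fun y hy => hy.1
  set g : Site 2 → ℝ := fun y => 1 - h y with hg
  -- `g` is harmonic on `S`
  have hgharm : IsLatticeSubharmonicOn g S := by
    intro y hy
    have hh := latticeLaplacian_eq_zero_of_interior (A := R.arc i) (A' := A') R.isOpen hharm hy.2
    have : g = (fun _ => (1 : ℝ)) - h := by funext y; simp [hg]
    rw [this, latticeLaplacian_sub, latticeLaplacian_const, hh, sub_zero]
  -- `g ≤ 1` on the outer boundary
  have hg1 : ∀ w ∈ latticeOuterBoundary S, g w ≤ 1 := fun w _ => by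
    simp only [hg]; linarith [(h01 w).1]
  -- `g ≤ 0` on the outer boundary inside the big box: those vertices are in `A_n`
  have hdomS : ∀ w ∈ latticeOuterBoundary S, w ∈ domain Ω δ ∧ w ∉ S := by
    rintro w ⟨hwS, v, hv, k, rfl⟩
    exact ⟨mem_domain_of_adj hv.1 (domainGraph_adj_iff.1 (hv.2 k)).1, hwS⟩
  have hg0 : ∀ w ∈ latticeOuterBoundary S, w ∈ sqBox p Rb → g w ≤ 0 := by
    intro w hw hwbox
    obtain ⟨hwD, hwS⟩ := hdomS w hw
    -- a missing edge at `w`, meeting `∂Ω` at a point `f`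
    have : ¬ ∀ k : Fin 4, (domainGraph Ω δ).Adj w (w + cornerUnit k) := fun hall => hwS ⟨hwD, hall⟩
    push Not at this
    obtain ⟨k, hk⟩ := this
    have hk' : ¬ (innerGraph Ω δ).Adj w (w + cornerUnit k) := fun hin =>
      hk ((domainGraph_adj_iff_of_mem hwD).2 hin)
    obtain ⟨f, hf, hff⟩ := exists_mem_frontier_of_not_adj R.isOpen h0 hwD (cSrc_mem_edgeSet (w, k)) hk'
    -- `f` is within `rA` of `q`, hence on the arc `i`
    have hfw : dist f (meshPoint δ w) ≤ δ := by
      have hsub : segment ℝ (meshPoint δ w) (meshPoint δ (w + cornerUnit k)) ⊆ closedBall (meshPoint δ w) |δ| :=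
        (convex_closedBall _ _).segment_subset (mem_closedBall_self (abs_nonneg δ))
          (by rw [mem_closedBall, _root_.dist_comm, Percolation.dist_meshPoint_of_adj (cSrc_mem_edgeSet (w, k))])
      have := hsub hf
      rwa [mem_closedBall, abs_of_pos hδ] at this
    have hwe : dist (meshPoint δ w) e₀ ≤ 2 * δ * (Rb + 1) := by
      rw [Complex.dist_eq]
      refine (Complex.norm_le_abs_re_add_abs_im _).trans ?_
      obtain ⟨hb0, hb1⟩ := mem_sqBox.1 hwbox
      simp only [Complex.sub_re, Complex.sub_im, meshPoint_re, meshPoint_im]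
      have hb0' : |((w 0 : ℝ)) - (p 0 : ℝ)| ≤ Rb := by
        rw [← Int.cast_sub, ← Int.cast_abs]; exact_mod_cast hb0
      have hb1' : |((w 1 : ℝ)) - (p 1 : ℝ)| ≤ Rb := by
        rw [← Int.cast_sub, ← Int.cast_abs]; exact_mod_cast hb1
      have e0 : δ * (w 0 : ℝ) - e₀.re = δ * ((w 0 : ℝ) - p 0) + (δ * (p 0 : ℝ) - e₀.re) := by ring
      have e1 : δ * (w 1 : ℝ) - e₀.im = δ * ((w 1 : ℝ) - p 1) + (δ * (p 1 : ℝ) - e₀.im) := by ring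
      rw [e0, e1]
      have a0 : |δ * ((w 0 : ℝ) - p 0)| ≤ δ * Rb := by rw [abs_mul, abs_of_pos hδ]; gcongr
      have a1 : |δ * ((w 1 : ℝ) - p 1)| ≤ δ * Rb := by rw [abs_mul, abs_of_pos hδ]; gcongr
      calc |δ * ((w 0 : ℝ) - p 0) + (δ * (p 0 : ℝ) - e₀.re)| + |δ * ((w 1 : ℝ) - p 1) + (δ * (p 1 : ℝ) - e₀.im)|
          ≤ (|δ * ((w 0 : ℝ) - p 0)| + |δ * (p 0 : ℝ) - e₀.re|) + (|δ * ((w 1 : ℝ) - p 1)| + |δ * (p 1 : ℝ) - e₀.im|) :=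
            add_le_add (abs_add_le _ _) (abs_add_le _ _)
        _ ≤ (δ * Rb + δ) + (δ * Rb + δ) := by gcongr
        _ = 2 * δ * (Rb + 1) := by ring
    have hfq : dist f q < rA := by
      have hRδ : 2 * δ * (Rb + 1) ≤ rA / 4 + 2 * δ := by
        have h1 := mul_le_mul_of_nonneg_left hRb2 (by positivity : (0 : ℝ) ≤ 2 * δ)
        rw [show 2 * δ * (rA / (8 * δ)) = rA / 4 by field_simp; ring] at h1
        linarith
      calc dist f q ≤ dist f (meshPoint δ w) + dist (meshPoint δ w) e₀ + dist e₀ q := dist_triangle4 _ _ _ _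
        _ ≤ δ + (rA / 4 + 2 * δ) + r := by
            gcongr
            · exact hwe.trans hRδ
            · rw [_root_.dist_comm]; exact hed.le
        _ < rA := by linarith
    have hfA : f ∈ R.arc i := hrA1 f hff hfq
    have hwA : w ∈ arcVertices Ω δ (R.arc i) :=
      ⟨⟨hwD, _, cSrc_mem_edgeSet (w, k), f, hf, hff⟩, _, cSrc_mem_edgeSet (w, k), f, hf, hfA⟩
    have := hA hwA
    simp only [hg, Pi.one_apply] at this ⊢
    linarith
  -- no circuits of `S` around the exterior face `p`
  have hW : ∀ (c : Site 2) (W : (zdGraph 2).Walk c c), (∀ z ∈ W.support, z ∈ S ∧ z ∈ sqBox p Rb) →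
      Percolation.walkWinding W p = 0 := by
    intro c W hWs
    refine walkWinding_eq_zero_of_mem_exterior R.isBounded R.isConnected_exterior hδ
      he₀ W fun dw hdw => ?_
    have hu : dw.fst ∈ S := (hWs _ (W.dart_fst_mem_support_of_mem_darts hdw)).1
    obtain ⟨k, hk⟩ := WeakBeurling.exists_eq_add_cornerUnit_of_adj dw.adj
    have := hu.2 k
    rw [← hk] at this
    exact (domainGraph_adj_iff.1 this).1
  -- `x ∈ S` and `x ∈ sqBox p ρ`
  have hxD : x ∈ domain Ω δ := (domainGraph_adj_iff.1 (hxint 0)).2.1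
  have hxS : x ∈ S := ⟨hxD, hxint⟩
  have hxbox : x ∈ sqBox p ρ := by
    have hxq : dist (meshPoint δ x) q < r := mem_ball.1 hx
    have hxe : dist (meshPoint δ x) e₀ < 2 * r := by
      calc dist (meshPoint δ x) e₀ ≤ dist (meshPoint δ x) q + dist q e₀ := dist_triangle _ _ _
        _ < r + r := add_lt_add hxq hed
        _ = 2 * r := by ring
    rw [Complex.dist_eq] at hxe
    have hre := (Complex.abs_re_le_norm (meshPoint δ x - e₀)).trans_lt hxe
    have him := (Complex.abs_im_le_norm (meshPoint δ x - e₀)).trans_lt hxe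
    simp only [Complex.sub_re, Complex.sub_im, meshPoint_re, meshPoint_im] at hre him
    have hρ' : 2 * r / δ < (ρ : ℝ) := by
      rw [hρ]; push_cast; linarith [Nat.lt_floor_add_one (2 * r / δ)]
    have key : ∀ (a b : ℤ) (u : ℝ), |δ * (a : ℝ) - u| < 2 * r → |δ * (b : ℝ) - u| ≤ δ → |a - b| ≤ (ρ : ℤ) := by
      intro a b u ha hb
      have h1 : |δ * ((a : ℝ) - b)| < 2 * r + δ := by
        calc |δ * ((a : ℝ) - b)| = |(δ * (a : ℝ) - u) - (δ * (b : ℝ) - u)| := by ring_nf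
          _ ≤ |δ * (a : ℝ) - u| + |δ * (b : ℝ) - u| := abs_sub _ _
          _ < 2 * r + δ := by linarith
      rw [abs_mul, abs_of_pos hδ] at h1
      have h2 : |((a : ℝ) - b)| < 2 * r / δ + 1 := by
        rw [div_add_one hδ.ne', lt_div_iff₀ hδ]; linarith
      have h3 : |((a - b : ℤ) : ℝ)| < (ρ : ℝ) + 1 := by push_cast; linarith
      have h4 : |a - b| < (ρ : ℤ) + 1 := by
        rw [← Int.cast_abs] at h3; exact_mod_cast h3
      omega
    rw [mem_sqBox]
    exact ⟨key _ _ _ hre hp0, key _ _ _ him hp1⟩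
  -- the Beurling estimate
  have hB := le_add_rpow_of_noCircuit hSfin hgharm hg1 (p := p) (R := Rb) (η := 0) le_rfl hg0 hW hxS hxbox
  rw [zero_add] at hB
  -- the ratio `(ρ + 1)/(Rb + 1) ≤ 64 θ = s₀`
  have hratio : ((ρ : ℝ) + 1) / ((Rb : ℝ) + 1) ≤ s₀ := by
    have hnum : (ρ : ℝ) + 1 ≤ 2 * r / δ + 2 := by
      rw [hρ]; push_cast; linarith [Nat.floor_le (show 0 ≤ 2 * r / δ by positivity)]
    have hden : rA / (8 * δ) ≤ (Rb : ℝ) + 1 := by linarith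
    have hden0 : 0 < rA / (8 * δ) := by positivity
    calc ((ρ : ℝ) + 1) / ((Rb : ℝ) + 1) ≤ (2 * r / δ + 2) / (rA / (8 * δ)) := by
          gcongr
        _ = (16 * r + 16 * δ) / rA := by field_simp; ring
        _ ≤ (16 * r + 16 * r) / rA := by gcongr
        _ = 32 * θ := by rw [hr]; field_simp; ring
        _ ≤ s₀ := by rw [hθ]; linarith
  have hpow : C * (((ρ : ℝ) + 1) / ((Rb : ℝ) + 1)) ^ β ≤ C * s₀ ^ β := by
    gcongr
  have : g x < ε := (hB.trans hpow).trans_lt hs₀le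
  simp only [hg] at this
  linarith

end BoundaryValues

end SquareTiling

end Literature.Probability.LatticeModels
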